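import Literature.Barriers.RiemannHypothesis.MollifierLimitations
import Literature.NumberTheory.LFunctions.SelfDualSmoothedAFE
import Literature.NumberTheory.LFunctions.EulerMaclaurinZetaHigher
import Literature.NumberTheory.LFunctions.HardyZFirstApprox
import Literature.Analysis.Fourier.SmoothWindowOscillatory
import HarnessLib

/-!
# Radziwiłł 2012, Proposition B without BCH, part D: smoothed first moments over `[T, 2T]`

Fourth file of the BCH-free proof of `Literature.Barriers.RiemannHypothesis.Radziwill2012_propB`
(M. Radziwiłł, *Limitations to mollifying ζ(s)*, arXiv:1207.6583, Proposition B: the lower bound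
`𝓘(M_θ) ≥ 1/θ + o(1)` for `θ < 1/2`). With the dyadic smooth window `w = w_{T,H}`
(`Literature.Analysis.Fourier.dyadicWindow`), the mollifier `M(s) = ∑_{k≤N} a(k) k^{-s}`
(`dirichletMollifier`), the smoothed main sum `S(t) = ∑_n ρ_n(t) n^{-1/2-it}` of the self-dual
approximate functional equation (`Literature.NumberTheory.LFunctions.SelfDualAFE.mainSum`) and the
Euler–Maclaurin approximation `ζ(1/2+it) = ∑_{ℓ ≤ L} ℓ^{-1/2-it} + O(T^{-1/4})`, `L = ⌊T^{3/2}⌋`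
(`norm_zeta_half_sub_sum_le`), this file evaluates the windowed first moments

* `∫ w ζ M = a(1) ∫ w + (off-diagonal)`,
* `∫ w |M|² = (∫ w) ∑ |a(k)|²/k + (off-diagonal)`,
* `∫ w ζ S̄ |M|² = ∑_{nh = ℓk} a(k) ā(h) ρ-weighted/(nh) + (off-diagonal)`, `∫ w |S M|² ≤ …`,

by one mechanism, `norm_integral_window_expSum_sub_le`: a windowed finite exponential sum
`∫ w(t) ∑_i c_i A_i(t) e^{iω_i t} dt` equals its resonant part (`ω_i = 0`) up to
`(∑_i |c_i|) C_k B T (H μ₀)^{-k}`, `μ₀` a lower bound for the non-zero frequencies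
(`Literature.Analysis.Fourier.norm_integral_dyadicWindow_mul_mul_cexp_le`). Everything here is
PROVED; there are no new definitions beyond abbreviations and no named facts.

## References

* [Radziwill2012] M. Radziwiłł, *Limitations to mollifying ζ(s)*, arXiv:1207.6583 (2012), Prop. B.
* [Titchmarsh1986] E. C. Titchmarsh, *The Theory of the Riemann Zeta-Function*, 2nd ed., §7.2
  (mean values of Dirichlet polynomials: diagonal and off-diagonal terms).
-/

noncomputable section

open Complex MeasureTheory Set Filter Finset Real
open scoped Real Topology ComplexConjugate ContDiff

namespace Literature.Barriers.RiemannHypothesis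

namespace PropBMoments

open Literature.Analysis.Fourier Literature.NumberTheory.LFunctions
open Literature.NumberTheory.LFunctions.SelfDualAFE
open Literature.NumberTheory.Sieve.MatomakiRadziwillL11 (conj_natCast_cpow)
open Literature.NumberTheory.LFunctions.TwistedMoment (natCast_cpow_neg_half_sub_eq
  natCast_cpow_neg_half_add_eq)

/-! ### The windowed finite exponential sum -/

/-- Integrability of a windowed smooth term `w(t) F(t)` with `F` continuous (`0 < H ≤ T`).
[folklore] -/
theorem integrable_dyadicWindow_mul {T H : ℝ} (hH : 0 < H) (hHT : H ≤ T) {F : ℝ → ℂ}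
    (hF : Continuous F) : Integrable (fun t => dyadicWindow T H t * F t) :=
  ((continuous_dyadicWindow T H).mul hF).integrable_of_hasCompactSupport
    (hasCompactSupport_dyadicWindow hH hHT).mul_right

/-- **Windowed finite exponential sums: resonant part plus a negligible remainder.** For a finite
family of coefficients `c_i`, real frequencies `ω_i` and smooth amplitudes `A_i` with
`‖A_i^{(j)}‖ ≤ B/T^j` on `[T, 2T]` (`j ≤ k`), and `μ₀ > 0` a lower bound for the non-zero `|ω_i|`:
`‖∫ w(t) ∑_i c_i A_i(t) e^{iω_i t} dt − ∑_{ω_i = 0} c_i ∫ w A_i‖ ≤ (∑_i ‖c_i‖) · C_k B T/(H μ₀)^k`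
(`1 ≤ H ≤ T`). [cite: Titchmarsh1986, §7.2] -/
theorem norm_integral_window_expSum_sub_le {ι : Type*} (s : Finset ι) (c : ι → ℂ) (fr : ι → ℝ)
    (A : ι → ℝ → ℂ) {T H : ℝ} (hH : 1 ≤ H) (hHT : H ≤ T) (k : ℕ) {B μ₀ : ℝ} (hB : 0 ≤ B)
    (hμ₀ : 0 < μ₀) (hA : ∀ i ∈ s, ContDiff ℝ ∞ (A i))
    (hAB : ∀ i ∈ s, ∀ j ≤ k, ∀ t ∈ Set.Icc T (2 * T), ‖iteratedDeriv j (A i) t‖ ≤ B / T ^ j)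
    (hfr : ∀ i ∈ s, fr i ≠ 0 → μ₀ ≤ |fr i|) :
    ‖(∫ t, dyadicWindow T H t * ∑ i ∈ s, c i * A i t * cexp (I * fr i * t))
        - ∑ i ∈ s.filter (fun i => fr i = 0), c i * ∫ t, dyadicWindow T H t * A i t‖
      ≤ (∑ i ∈ s, ‖c i‖) * (oscDecayConst k * B * T / (H * μ₀) ^ k) := by
  have hH0 : 0 < H := by linarith
  set w := dyadicWindow T H with hw
  -- integrability
  have hcont : ∀ i ∈ s, Continuous fun t => c i * A i t * cexp (I * fr i * t) := by
    intro i hi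
    exact (continuous_const.mul (hA i hi).continuous).mul (by fun_prop)
  have hint : ∀ i ∈ s, Integrable (fun t => w t * (c i * A i t * cexp (I * fr i * t))) :=
    fun i hi => integrable_dyadicWindow_mul hH0 hHT (hcont i hi)
  -- swap sum and integral
  have hswap : (∫ t, w t * ∑ i ∈ s, c i * A i t * cexp (I * fr i * t))
      = ∑ i ∈ s, ∫ t, w t * (c i * A i t * cexp (I * fr i * t)) := by
    rw [← integral_finsetSum s hint]
    refine integral_congr_ae (Filter.Eventually.of_forall fun t => ?_)
    simp only [Finset.mul_sum]
  rw [hswap, ← Finset.sum_filter_add_sum_filter_not s (fun i => fr i = 0)]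
  -- the resonant terms
  have hres : ∀ i ∈ s.filter (fun i => fr i = 0),
      (∫ t, w t * (c i * A i t * cexp (I * fr i * t))) = c i * ∫ t, w t * A i t := by
    intro i hi
    rw [Finset.mem_filter] at hi
    rw [← MeasureTheory.integral_const_mul]
    refine integral_congr_ae (Filter.Eventually.of_forall fun t => ?_)
    simp only [hi.2, Complex.ofReal_zero, mul_zero, zero_mul, Complex.exp_zero, mul_one]
    ring
  rw [Finset.sum_congr rfl hres, add_sub_cancel_left]
  -- the non-resonant terms
  have hterm : ∀ i ∈ s.filter (fun i => ¬ fr i = 0),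
      ‖∫ t, w t * (c i * A i t * cexp (I * fr i * t))‖
        ≤ ‖c i‖ * (oscDecayConst k * B * T / (H * μ₀) ^ k) := by
    intro i hi
    rw [Finset.mem_filter] at hi
    have h1 : (∫ t, w t * (c i * A i t * cexp (I * fr i * t)))
        = c i * ∫ t, w t * A i t * cexp (I * fr i * t) := by
      rw [← MeasureTheory.integral_const_mul]
      refine integral_congr_ae (Filter.Eventually.of_forall fun t => ?_)
      simp only; ring
    rw [h1, norm_mul]
    refine mul_le_mul_of_nonneg_left ?_ (norm_nonneg _)
    have hdec := norm_integral_dyadicWindow_mul_mul_cexp_le hH hHT (hA i hi.1) k hB (hAB i hi.1) hi.2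
    refine hdec.trans ?_
    have hμi : μ₀ ≤ |fr i| := hfr i hi.1 hi.2
    have hpow : (H * μ₀) ^ k ≤ (H * |fr i|) ^ k :=
      pow_le_pow_left₀ (by positivity) (mul_le_mul_of_nonneg_left hμi hH0.le) k
    exact div_le_div_of_nonneg_left (by
      have := oscDecayConst_nonneg k
      have hT : 0 ≤ T := by linarith
      positivity) (by positivity) hpow
  calc ‖∑ i ∈ s.filter (fun i => ¬ fr i = 0), ∫ t, w t * (c i * A i t * cexp (I * fr i * t))‖
      ≤ ∑ i ∈ s.filter (fun i => ¬ fr i = 0), ‖∫ t, w t * (c i * A i t * cexp (I * fr i * t))‖ :=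
        norm_sum_le _ _
    _ ≤ ∑ i ∈ s.filter (fun i => ¬ fr i = 0), ‖c i‖ * (oscDecayConst k * B * T / (H * μ₀) ^ k) :=
        Finset.sum_le_sum hterm
    _ ≤ ∑ i ∈ s, ‖c i‖ * (oscDecayConst k * B * T / (H * μ₀) ^ k) := by
        apply Finset.sum_le_sum_of_subset_of_nonneg (Finset.filter_subset _ _)
        intro i _ _
        have := oscDecayConst_nonneg k
        have hT : 0 ≤ T := by linarith
        positivity
    _ = (∑ i ∈ s, ‖c i‖) * (oscDecayConst k * B * T / (H * μ₀) ^ k) := by rw [Finset.sum_mul]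

/-- The constant-amplitude case of `norm_integral_window_expSum_sub_le` (`A_i = 1`, `B = 1`).
[cite: Titchmarsh1986, §7.2] -/
theorem norm_integral_window_expSum_sub_le' {ι : Type*} (s : Finset ι) (c : ι → ℂ) (fr : ι → ℝ)
    {T H : ℝ} (hH : 1 ≤ H) (hHT : H ≤ T) (k : ℕ) {μ₀ : ℝ} (hμ₀ : 0 < μ₀)
    (hfr : ∀ i ∈ s, fr i ≠ 0 → μ₀ ≤ |fr i|) :
    ‖(∫ t, dyadicWindow T H t * ∑ i ∈ s, c i * cexp (I * fr i * t))
        - (∑ i ∈ s.filter (fun i => fr i = 0), c i) * ∫ t, dyadicWindow T H t‖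
      ≤ (∑ i ∈ s, ‖c i‖) * (oscDecayConst k * T / (H * μ₀) ^ k) := by
  have hT : 0 < T := by linarith
  have h := norm_integral_window_expSum_sub_le s c fr (fun _ _ => (1 : ℂ)) hH hHT k zero_le_one hμ₀
    (fun _ _ => contDiff_const)
    (fun i _ j _ t _ => by
      rw [iteratedDeriv_const]
      split_ifs with hj
      · subst hj; simp
      · rw [norm_zero]; positivity) hfr
  simp only [mul_one, Finset.sum_mul] at h ⊢
  exact h

/-! ### Frequencies of Dirichlet polynomials: separation of logarithms of integers -/

/-- For positive reals `p ≠ q` with `q ≤ 2p` and `p ≤ 2q`... in fact for all positive `p, q`: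
`|log p − log q| ≥ |p − q| / max p q`. [folklore] -/
theorem abs_log_sub_log_ge {p q : ℝ} (hp : 0 < p) (hq : 0 < q) :
    |p - q| / max p q ≤ |Real.log p - Real.log q| := by
  wlog hpq : q ≤ p generalizing p q
  · have h := this hq hp (le_of_not_ge hpq)
    rwa [abs_sub_comm, max_comm, abs_sub_comm (Real.log q)] at h
  rw [max_eq_left hpq, abs_of_nonneg (by linarith), abs_of_nonneg (by
    have := Real.log_le_log hq hpq; linarith)]
  -- `log p - log q = -log(q/p) ≥ 1 - q/p = (p - q)/p`
  have h1 : Real.log (q / p) ≤ q / p - 1 := Real.log_le_sub_one_of_pos (by positivity)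
  rw [Real.log_div hq.ne' hp.ne'] at h1
  rw [div_le_iff₀ hp]
  have : (q / p - 1) * p = q - p := by field_simp
  nlinarith [h1, this]

/-- **Separation of frequencies.** For positive integers `p ≠ q` both `≤ X` (`1 ≤ X`):
`|log p − log q| ≥ 1/X`. [folklore] -/
theorem abs_log_sub_log_ge_inv {p q : ℕ} (hp : 0 < p) (hq : 0 < q) (hpq : p ≠ q) {X : ℝ}
    (hpX : (p : ℝ) ≤ X) (hqX : (q : ℝ) ≤ X) :
    1 / X ≤ |Real.log p - Real.log q| := by
  have hpR : (0 : ℝ) < p := by exact_mod_cast hp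
  have hqR : (0 : ℝ) < q := by exact_mod_cast hq
  have hX : 0 < X := hpR.trans_le hpX
  refine le_trans ?_ (abs_log_sub_log_ge hpR hqR)
  have h1 : (1 : ℝ) ≤ |(p : ℝ) - q| := by
    have : (1 : ℤ) ≤ |(p : ℤ) - q| := Int.one_le_abs (sub_ne_zero.2 (by exact_mod_cast hpq))
    have h' : ((1 : ℤ) : ℝ) ≤ ((|(p : ℤ) - q| : ℤ) : ℝ) := by exact_mod_cast this
    simpa using h'
  have h2 : max (p : ℝ) q ≤ X := max_le hpX hqX
  calc 1 / X ≤ 1 / max (p : ℝ) q := div_le_div_of_nonneg_left zero_le_one (by positivity) h2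
    _ ≤ |(p : ℝ) - q| / max (p : ℝ) q := div_le_div_of_nonneg_right h1 (by positivity)

/-- **Separation of frequencies, ratio form.** For positive integers with `p ≠ q` and
`q ≤ Y`: `|log p − log q| ≥ min (log 2) (1/(2Y))`; since `log 2 ≥ 1/2 ≥ 1/(2Y)` for `Y ≥ 1`, simply
`|log p − log q| ≥ 1/(2Y)`. (If `p ≤ 2q` both are `≤ 2Y`; otherwise the logarithms differ by
`≥ log 2`.) [folklore] -/
theorem abs_log_sub_log_ge_inv' {p q : ℕ} (hp : 0 < p) (hq : 0 < q) (hpq : p ≠ q) {Y : ℝ}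
    (hY : 1 ≤ Y) (hqY : (q : ℝ) ≤ Y) :
    1 / (2 * Y) ≤ |Real.log p - Real.log q| := by
  have hpR : (0 : ℝ) < p := by exact_mod_cast hp
  have hqR : (0 : ℝ) < q := by exact_mod_cast hq
  rcases le_or_gt (p : ℝ) (2 * Y) with h2 | h2
  · -- both `≤ 2Y`
    exact abs_log_sub_log_ge_inv hp hq hpq h2 (by linarith)
  · -- `p > 2Y ≥ 2q`: `log p - log q ≥ log 2 ≥ 1/2 ≥ 1/(2Y)`
    have hp2q : 2 * (q : ℝ) ≤ p := by linarith
    have hlog : Real.log 2 ≤ Real.log p - Real.log q := by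
      rw [← Real.log_div hpR.ne' hqR.ne', Real.le_log_iff_exp_le (by positivity), Real.exp_log (by norm_num)]
      rw [le_div_iff₀ hqR]; linarith
    have hlog2 : (1 / 2 : ℝ) ≤ Real.log 2 := by
      have := Real.log_two_gt_d9; linarith
    calc 1 / (2 * Y) ≤ 1 / 2 :=
          one_div_le_one_div_of_le (by norm_num) (by linarith)
      _ ≤ |Real.log p - Real.log q| := by
          rw [abs_of_nonneg (by linarith)]; linarith

/-! ### The Euler–Maclaurin approximation of `ζ(1/2+it)` on `[T, 2T]` by a sum of length `T^{3/2}` -/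

/-- The length `L_T = ⌊T^{3/2}⌋` of the Euler–Maclaurin sum. [folklore] -/
def emLen (T : ℝ) : ℕ := ⌊T ^ (3 / 2 : ℝ)⌋₊

/-- Unfolding lemma. [folklore] -/
theorem emLen_def (T : ℝ) : emLen T = ⌊T ^ (3 / 2 : ℝ)⌋₊ := rfl

/-- `T^{3/2} - 1 < L_T ≤ T^{3/2}` and `L_T + 1 ≥ T^{3/2}`. [folklore] -/
theorem emLen_bounds {T : ℝ} (hT : 0 ≤ T) :
    (emLen T : ℝ) ≤ T ^ (3 / 2 : ℝ) ∧ T ^ (3 / 2 : ℝ) ≤ (emLen T : ℝ) + 1 :=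
  ⟨Nat.floor_le (by positivity), (Nat.lt_floor_add_one _).le⟩

/-- **`ζ(1/2+it) = ∑_{ℓ ≤ L_T} ℓ^{-1/2-it} + O(T^{-1/4})` on `[T, 2T]`** (Euler–Maclaurin of order
one with `N = L_T + 1 ≥ T^{3/2}`: the terms `N^{1-s}/(s-1)`, `N^{-s}/2`, `(B₂/2) s N^{-s-1}` and the
remainder `−(s(s+1)(s+2)/3!)∫_N^∞ B̄₃ x^{-s-3}` are each `≤ 3 T^{-1/4}` for `T ≥ 1`).
[cite: Titchmarsh1986, §7.2] -/
theorem norm_zeta_half_sub_sum_le {T : ℝ} (hT : 1 ≤ T) {t : ℝ} (ht : t ∈ Set.Icc T (2 * T)) :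
    ‖riemannZeta (1 / 2 + t * I)
        - ∑ n ∈ Finset.Icc 1 (emLen T), (n : ℂ) ^ (-(1 / 2 + t * I))‖ ≤ 12 * T ^ (-(1 / 4 : ℝ)) := by
  have hT0 : 0 < T := by linarith
  have ht1 : T ≤ t := ht.1
  have ht2 : t ≤ 2 * T := ht.2
  have ht0 : 0 < t := by linarith
  set s : ℂ := 1 / 2 + t * I with hs
  have hsre : s.re = 1 / 2 := by simp [hs]
  have hsim : s.im = t := by simp [hs]
  have hs0 : 0 < s.re := by rw [hsre]; norm_num
  have hs1 : s ≠ 1 := by intro h; have := congrArg Complex.im h; simp [hsim] at this; linarith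
  set L : ℕ := emLen T with hL
  set N : ℕ := L + 1 with hN
  have hN1 : 1 ≤ N := by omega
  have hNpos : (0 : ℝ) < N := by exact_mod_cast hN1
  have hLb := emLen_bounds hT0.le
  have hNge : T ^ (3 / 2 : ℝ) ≤ (N : ℝ) := by rw [hN]; push_cast; exact hLb.2
  have hNle : (N : ℝ) ≤ T ^ (3 / 2 : ℝ) + 1 := by rw [hN]; push_cast; linarith [hLb.1]
  -- Euler–Maclaurin of order one
  have hEM := riemannZeta_eq_eulerMaclaurin_of_re_pos hN1 hs0 hs1 1
  have hsum : ∑ n ∈ Finset.Icc 1 L, (n : ℂ) ^ (-s) = ∑ n ∈ Finset.Ico 1 N, (n : ℂ) ^ (-s) := by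
    rw [hN, Finset.Ico_add_one_right_eq_Icc]
  have hdiff : riemannZeta s - ∑ n ∈ Finset.Icc 1 L, (n : ℂ) ^ (-s)
      = (N : ℂ) ^ (1 - s) / (s - 1) + (N : ℂ) ^ (-s) / 2 + emTerm N s 1 + emRemHigher N 1 s := by
    rw [hEM, hsum, emMainZero, Finset.Icc_self, Finset.sum_singleton]; ring
  rw [hdiff]
  -- norms of the pieces
  have hnormN : ∀ w : ℂ, ‖(N : ℂ) ^ w‖ = (N : ℝ) ^ w.re := fun w =>
    Complex.norm_natCast_cpow_of_pos (by omega) w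
  have hsnorm : ‖s‖ ≤ 2 * t + 1 := by
    calc ‖s‖ ≤ ‖(1 / 2 : ℂ)‖ + ‖(t : ℂ) * I‖ := norm_add_le _ _
      _ = 1 / 2 + t := by
          rw [norm_mul, Complex.norm_I, mul_one, Complex.norm_real, Real.norm_eq_abs, abs_of_pos ht0]
          norm_num
      _ ≤ 2 * t + 1 := by linarith
  have hs5T : ‖s‖ ≤ 5 * T := by linarith
  -- useful powers of `T`
  have hT14 : 0 < T ^ (-(1 / 4 : ℝ)) := Real.rpow_pos_of_pos hT0 _
  have hN32 : (N : ℝ) ^ (-(1 / 2 : ℝ)) ≤ T ^ (-(3 / 4 : ℝ)) := by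
    calc (N : ℝ) ^ (-(1 / 2 : ℝ)) ≤ (T ^ (3 / 2 : ℝ)) ^ (-(1 / 2 : ℝ)) :=
          Real.rpow_le_rpow_of_nonpos (by positivity) hNge (by norm_num)
      _ = T ^ (-(3 / 4 : ℝ)) := by rw [← Real.rpow_mul hT0.le]; norm_num
  have hT34le : T ^ (-(3 / 4 : ℝ)) ≤ T ^ (-(1 / 4 : ℝ)) :=
    Real.rpow_le_rpow_of_exponent_le hT (by norm_num)
  -- (1) `‖N^{1-s}/(s-1)‖ ≤ √N / T ≤ 2 T^{-1/4}`
  have h1 : ‖(N : ℂ) ^ (1 - s) / (s - 1)‖ ≤ 2 * T ^ (-(1 / 4 : ℝ)) := by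
    rw [norm_div, hnormN]
    have hre : (1 - s).re = 1 / 2 := by simp [hsre]; norm_num
    rw [hre]
    have hden : T ≤ ‖s - 1‖ := by
      have := Complex.abs_im_le_norm (s - 1)
      simp only [Complex.sub_im, Complex.one_im, sub_zero, hsim] at this
      rw [abs_of_pos ht0] at this; linarith
    have hnum : (N : ℝ) ^ (1 / 2 : ℝ) ≤ 2 * T ^ (3 / 4 : ℝ) := by
      have h2T : (N : ℝ) ≤ 4 * T ^ (3 / 2 : ℝ) := by
        have : 1 ≤ T ^ (3 / 2 : ℝ) := Real.one_le_rpow hT (by norm_num)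
        linarith
      calc (N : ℝ) ^ (1 / 2 : ℝ) ≤ (4 * T ^ (3 / 2 : ℝ)) ^ (1 / 2 : ℝ) :=
            Real.rpow_le_rpow (by positivity) h2T (by norm_num)
        _ = 2 * T ^ (3 / 4 : ℝ) := by
            rw [Real.mul_rpow (by norm_num) (by positivity), ← Real.rpow_mul hT0.le,
              show (4 : ℝ) = 2 ^ (2 : ℝ) by norm_num, ← Real.rpow_mul (by norm_num)]
            norm_num
    calc (N : ℝ) ^ (1 / 2 : ℝ) / ‖s - 1‖ ≤ (2 * T ^ (3 / 4 : ℝ)) / T := by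
          gcongr
      _ = 2 * T ^ (-(1 / 4 : ℝ)) := by
          rw [show T ^ (-(1 / 4 : ℝ)) = T ^ (3 / 4 : ℝ) / T by
            rw [eq_div_iff hT0.ne', ← Real.rpow_add_one hT0.ne']; norm_num]
          ring
  -- (2) `‖N^{-s}/2‖ ≤ T^{-3/4}/2 ≤ T^{-1/4}`
  have h2 : ‖(N : ℂ) ^ (-s) / 2‖ ≤ T ^ (-(1 / 4 : ℝ)) := by
    rw [norm_div, hnormN, Complex.neg_re, hsre]
    simp only [Complex.norm_ofNat]
    linarith [hN32, hT34le]
  -- (3) the correction term `(B₂/2!) s N^{-(s+1)}`, `B₂ = 1/6`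
  have h3 : ‖emTerm N s 1‖ ≤ T ^ (-(1 / 4 : ℝ)) := by
    simp only [emTerm, emPoch_one, Nat.mul_one, show 2 * 1 - 1 = 1 from rfl, Nat.cast_one]
    rw [norm_mul, norm_mul, norm_div, hnormN]
    have hB2 : ‖(bernoulli 2 : ℂ)‖ = 1 / 6 := by
      rw [bernoulli_eq_bernoulli'_of_ne_one (by norm_num), bernoulli'_two]; norm_num
    have hfac : ‖((2 : ℕ).factorial : ℂ)‖ = 2 := by norm_num [Nat.factorial]
    rw [hB2, hfac]
    have hre : (-(s + (1 : ℂ))).re = -(3 / 2 : ℝ) := by simp [hsre]; norm_num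
    rw [hre]
    have hN3 : (N : ℝ) ^ (-(3 / 2 : ℝ)) ≤ T ^ (-(9 / 4 : ℝ)) := by
      calc (N : ℝ) ^ (-(3 / 2 : ℝ)) ≤ (T ^ (3 / 2 : ℝ)) ^ (-(3 / 2 : ℝ)) :=
            Real.rpow_le_rpow_of_nonpos (by positivity) hNge (by norm_num)
        _ = T ^ (-(9 / 4 : ℝ)) := by rw [← Real.rpow_mul hT0.le]; norm_num
    have hsplit : T ^ (-(9 / 4 : ℝ)) = T ^ (-(1 / 4 : ℝ)) * T ^ (-(2 : ℝ)) := by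
      rw [← Real.rpow_add hT0]; norm_num
    have hT2 : T ^ (-(2 : ℝ)) = 1 / T ^ 2 := by
      rw [Real.rpow_neg hT0.le, one_div]; norm_num
    calc 1 / 6 / 2 * ‖s‖ * (N : ℝ) ^ (-(3 / 2 : ℝ)) ≤ 1 / 6 / 2 * (5 * T) * T ^ (-(9 / 4 : ℝ)) := by
          gcongr
      _ = 5 / 12 * (T ^ (-(1 / 4 : ℝ)) * (T * T ^ (-(2 : ℝ)))) := by rw [hsplit]; ring
      _ ≤ 5 / 12 * (T ^ (-(1 / 4 : ℝ)) * 1) := by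
          gcongr
          rw [hT2]; rw [mul_one_div, div_le_one (by positivity)]; nlinarith
      _ ≤ T ^ (-(1 / 4 : ℝ)) := by linarith
  -- (4) the remainder
  have h4 : ‖emRemHigher N 1 s‖ ≤ 8 * T ^ (-(1 / 4 : ℝ)) := by
    have h := norm_emRemHigher_le hN1 hs0 (ν := 1) one_ne_zero
    refine h.trans ?_
    rw [hsre]
    -- `‖s(s+1)(s+2)‖ ≤ (5T+2)³ ≤ (7T)³`
    have hpoch : ‖emPoch s (2 * 1 + 1)‖ ≤ (7 * T) ^ 3 := by
      simp only [emPoch, show 2 * 1 + 1 = 3 from rfl, Finset.prod_range_succ, Finset.prod_range_zero,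
        one_mul, Nat.cast_zero, add_zero, Nat.cast_one, Nat.cast_ofNat, norm_mul]
      have ha : ‖s + 1‖ ≤ 7 * T := by
        calc ‖s + 1‖ ≤ ‖s‖ + ‖(1 : ℂ)‖ := norm_add_le _ _
          _ ≤ 5 * T + 1 := by simp; linarith
          _ ≤ 7 * T := by linarith
      have hb : ‖s + 2‖ ≤ 7 * T := by
        calc ‖s + 2‖ ≤ ‖s‖ + ‖(2 : ℂ)‖ := norm_add_le _ _
          _ ≤ 5 * T + 2 := by simp; linarith
          _ ≤ 7 * T := by linarith
      have hc : ‖s‖ ≤ 7 * T := by linarith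
      calc ‖s‖ * ‖s + 1‖ * ‖s + 2‖ ≤ (7 * T) * (7 * T) * (7 * T) := by
            gcongr
        _ = (7 * T) ^ 3 := by ring
    have hconst : Real.pi ^ 2 / 3 / (2 * Real.pi) ^ (2 * 1 + 1) ≤ 1 / 60 := by
      have hπ3 := Real.pi_gt_three
      have hπ4 := Real.pi_lt_four
      rw [show 2 * 1 + 1 = 3 from rfl, div_le_iff₀ (by positivity)]
      nlinarith [pow_pos Real.pi_pos 3, mul_pos Real.pi_pos Real.pi_pos]
    have hNpow : (N : ℝ) ^ (-(1 / 2 + 2 * (1 : ℕ) : ℝ)) / (1 / 2 + 2 * (1 : ℕ)) ≤ T ^ (-(15 / 4 : ℝ)) := by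
      have e1 : (-(1 / 2 + 2 * (1 : ℕ) : ℝ)) = -(5 / 2 : ℝ) := by norm_num
      have e2 : (1 / 2 + 2 * (1 : ℕ) : ℝ) = 5 / 2 := by norm_num
      rw [e1, e2]
      have hN5 : (N : ℝ) ^ (-(5 / 2 : ℝ)) ≤ T ^ (-(15 / 4 : ℝ)) := by
        calc (N : ℝ) ^ (-(5 / 2 : ℝ)) ≤ (T ^ (3 / 2 : ℝ)) ^ (-(5 / 2 : ℝ)) :=
              Real.rpow_le_rpow_of_nonpos (by positivity) hNge (by norm_num)
          _ = T ^ (-(15 / 4 : ℝ)) := by rw [← Real.rpow_mul hT0.le]; norm_num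
      have h0 : 0 ≤ (N : ℝ) ^ (-(5 / 2 : ℝ)) := by positivity
      calc (N : ℝ) ^ (-(5 / 2 : ℝ)) / (5 / 2) ≤ (N : ℝ) ^ (-(5 / 2 : ℝ)) := by
            rw [div_le_iff₀ (by norm_num)]; nlinarith
        _ ≤ T ^ (-(15 / 4 : ℝ)) := hN5
    have hsplit : T ^ (-(15 / 4 : ℝ)) = T ^ (-(1 / 4 : ℝ)) * (T ^ 3)⁻¹ * (Real.sqrt T)⁻¹ := by
      rw [Real.sqrt_eq_rpow, ← Real.rpow_natCast, ← Real.rpow_neg hT0.le, ← Real.rpow_neg hT0.le,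
        ← Real.rpow_add hT0, ← Real.rpow_add hT0]
      norm_num
    have hsqrt : 1 ≤ Real.sqrt T := by rw [Real.le_sqrt (by norm_num) hT0.le]; linarith
    calc ‖emPoch s (2 * 1 + 1)‖ * (Real.pi ^ 2 / 3 / (2 * Real.pi) ^ (2 * 1 + 1)) *
          ((N : ℝ) ^ (-(1 / 2 + 2 * (1 : ℕ) : ℝ)) / (1 / 2 + 2 * (1 : ℕ)))
        ≤ (7 * T) ^ 3 * (1 / 60) * T ^ (-(15 / 4 : ℝ)) :=
          mul_le_mul (mul_le_mul hpoch hconst (by positivity) (by positivity)) hNpow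
            (by positivity) (by positivity)
      _ = 343 / 60 * (T ^ (-(1 / 4 : ℝ)) * (T ^ 3 * (T ^ 3)⁻¹) * (Real.sqrt T)⁻¹) := by
          rw [hsplit]; ring
      _ = 343 / 60 * (T ^ (-(1 / 4 : ℝ)) * (Real.sqrt T)⁻¹) := by
          rw [mul_inv_cancel₀ (by positivity), mul_one]
      _ ≤ 343 / 60 * (T ^ (-(1 / 4 : ℝ)) * 1) := by
          gcongr
          exact inv_le_one_of_one_le₀ hsqrt
      _ ≤ 8 * T ^ (-(1 / 4 : ℝ)) := by linarith
  calc ‖(N : ℂ) ^ (1 - s) / (s - 1) + (N : ℂ) ^ (-s) / 2 + emTerm N s 1 + emRemHigher N 1 s‖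
      ≤ ‖(N : ℂ) ^ (1 - s) / (s - 1)‖ + ‖(N : ℂ) ^ (-s) / 2‖ + ‖emTerm N s 1‖ + ‖emRemHigher N 1 s‖ := by
        refine (norm_add_le _ _).trans (add_le_add ((norm_add_le _ _).trans (add_le_add
          (norm_add_le _ _) le_rfl)) le_rfl)
    _ ≤ 2 * T ^ (-(1 / 4 : ℝ)) + T ^ (-(1 / 4 : ℝ)) + T ^ (-(1 / 4 : ℝ)) + 8 * T ^ (-(1 / 4 : ℝ)) := by
        linarith [h1, h2, h3, h4]
    _ = 12 * T ^ (-(1 / 4 : ℝ)) := by ring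

/-! ### The mollifier on the critical line -/

/-- `M(t) = ∑_{k ≤ N} a(k) k^{-1/2-it}`, the mollifier on the critical line. [cite: Radziwill2012, (1)] -/
abbrev Mt (a : ℕ → ℂ) (N : ℕ) (t : ℝ) : ℂ := dirichletMollifier a N (1 / 2 + t * I)

/-- `‖e^{ixt}‖ = 1` for real `x, t`. [folklore] -/
theorem norm_cexp_I_mul_mul (x t : ℝ) : ‖cexp (I * (x : ℂ) * (t : ℂ))‖ = 1 := by
  rw [show I * (x : ℂ) * t = ((x * t : ℝ) : ℂ) * I by push_cast; ring, Complex.norm_exp_ofReal_mul_I]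

/-- The coefficient `a(k) k^{-1/2}` and the phase: `a(k) k^{-(1/2+it)} = a(k) k^{-1/2} e^{i(−log k)t}`.
[folklore] -/
theorem mollifier_term_eq {k : ℕ} (hk : 0 < k) (a : ℕ → ℂ) (t : ℝ) :
    a k * (k : ℂ) ^ (-(1 / 2 + t * I))
      = a k * (((k : ℝ) ^ (-(1 / 2 : ℝ)) : ℝ) : ℂ) * cexp (I * ((-Real.log k : ℝ) : ℂ) * (t : ℂ)) := by
  rw [show (-(1 / 2 + t * I) : ℂ) = -(1 / 2 : ℂ) - t * I by ring, natCast_cpow_neg_half_sub_eq hk t]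
  have : cexp (-(I * t * Real.log k)) = cexp (I * ((-Real.log k : ℝ) : ℂ) * (t : ℂ)) := by
    congr 1; push_cast; ring
  rw [this]; ring

/-- The conjugate term: `conj(a(h) h^{-(1/2+it)}) = conj a(h) · h^{-1/2} e^{i(log h)t}`. [folklore] -/
theorem conj_mollifier_term_eq {h : ℕ} (hh : 0 < h) (a : ℕ → ℂ) (t : ℝ) :
    conj (a h * (h : ℂ) ^ (-(1 / 2 + t * I)))
      = conj (a h) * (((h : ℝ) ^ (-(1 / 2 : ℝ)) : ℝ) : ℂ) * cexp (I * ((Real.log h : ℝ) : ℂ) * (t : ℂ)) := by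
  rw [map_mul, conj_natCast_cpow]
  have e1 : conj (-(1 / 2 + (t : ℂ) * I)) = -(1 / 2 : ℂ) + t * I := by
    apply Complex.ext <;> simp
  rw [e1, natCast_cpow_neg_half_add_eq hh t]
  have : cexp (I * t * Real.log h) = cexp (I * ((Real.log h : ℝ) : ℂ) * (t : ℂ)) := by
    congr 1; ring
  rw [this]; ring

/-- `M(t)` as a sum of phases. [folklore] -/
theorem Mt_eq_sum (a : ℕ → ℂ) (N : ℕ) (t : ℝ) :
    Mt a N t = ∑ k ∈ Finset.Icc 1 N,
      a k * (((k : ℝ) ^ (-(1 / 2 : ℝ)) : ℝ) : ℂ) * cexp (I * ((-Real.log k : ℝ) : ℂ) * (t : ℂ)) := by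
  simp only [Mt, dirichletMollifier]
  exact Finset.sum_congr rfl fun k hk => mollifier_term_eq (Finset.mem_Icc.1 hk).1 a t

/-- `conj M(t)` as a sum of phases. [folklore] -/
theorem conj_Mt_eq_sum (a : ℕ → ℂ) (N : ℕ) (t : ℝ) :
    conj (Mt a N t) = ∑ h ∈ Finset.Icc 1 N,
      conj (a h) * (((h : ℝ) ^ (-(1 / 2 : ℝ)) : ℝ) : ℂ) * cexp (I * ((Real.log h : ℝ) : ℂ) * (t : ℂ)) := by
  simp only [Mt, dirichletMollifier, map_sum]
  exact Finset.sum_congr rfl fun h hh => conj_mollifier_term_eq (Finset.mem_Icc.1 hh).1 a t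

/-- `‖M(t)‖ ≤ ∑_{k ≤ N} ‖a(k)‖ k^{-1/2}`. [folklore] -/
theorem norm_Mt_le (a : ℕ → ℂ) (N : ℕ) (t : ℝ) :
    ‖Mt a N t‖ ≤ ∑ k ∈ Finset.Icc 1 N, ‖a k‖ * (k : ℝ) ^ (-(1 / 2 : ℝ)) := by
  rw [Mt_eq_sum]
  refine (norm_sum_le _ _).trans (Finset.sum_le_sum fun k hk => ?_)
  have hk0 : (0 : ℝ) < k := by exact_mod_cast (Finset.mem_Icc.1 hk).1
  rw [norm_mul, norm_mul, Complex.norm_real, Real.norm_eq_abs, abs_of_nonneg (by positivity),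
    norm_cexp_I_mul_mul, mul_one]

/-- `M` is continuous in `t`. [folklore] -/
theorem continuous_Mt (a : ℕ → ℂ) (N : ℕ) : Continuous (Mt a N) := by
  have : Mt a N = fun t : ℝ => ∑ k ∈ Finset.Icc 1 N,
      a k * (((k : ℝ) ^ (-(1 / 2 : ℝ)) : ℝ) : ℂ) * cexp (I * ((-Real.log k : ℝ) : ℂ) * (t : ℂ)) :=
    funext (Mt_eq_sum a N)
  rw [this]
  exact continuous_finsetSum _ fun k _ => by fun_prop

/-- `∫ w` is the integral of the real window. [folklore] -/
theorem integral_dyadicWindow_eq (T H : ℝ) :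
    ∫ t, dyadicWindow T H t = ((∫ t, dyadicWindowRe T H t : ℝ) : ℂ) := by
  rw [← integral_complex_ofReal]
  exact integral_congr_ae (Filter.Eventually.of_forall fun t => dyadicWindow_eq_ofReal T H t)

/-! ### `∫ w |M|²`: the diagonal `(∫ w) ∑ |a(k)|²/k` and the off-diagonal terms -/

/-- **The windowed mean square of the mollifier.** For `1 ≤ H ≤ T`, `N ≥ 1` and every `k`:
`‖∫ w |M|² − (∑_{k≤N} |a(k)|²/k) ∫ w‖ ≤ (∑_{k≤N} |a(k)| k^{-1/2})² · C_k T (H/N)^{-k}`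
(off-diagonal frequencies `log h − log k`, `|·| ≥ 1/N`). [cite: Titchmarsh1986, §7.2] -/
theorem norm_integral_window_normSq_Mt_sub_le (a : ℕ → ℂ) {N : ℕ} (hN : 1 ≤ N) {T H : ℝ}
    (hH : 1 ≤ H) (hHT : H ≤ T) (k : ℕ) :
    ‖(∫ t, dyadicWindow T H t * ((‖Mt a N t‖ ^ 2 : ℝ) : ℂ))
        - (∑ k ∈ Finset.Icc 1 N, (((‖a k‖ ^ 2 / k : ℝ)) : ℂ)) * ∫ t, dyadicWindow T H t‖
      ≤ (∑ k ∈ Finset.Icc 1 N, ‖a k‖ * (k : ℝ) ^ (-(1 / 2 : ℝ))) ^ 2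
          * (oscDecayConst k * T / (H * (1 / N)) ^ k) := by
  -- coefficients and frequencies on `Icc 1 N × Icc 1 N`
  set S : Finset (ℕ × ℕ) := Finset.Icc 1 N ×ˢ Finset.Icc 1 N with hS
  set c : ℕ × ℕ → ℂ := fun p => a p.1 * (((p.1 : ℝ) ^ (-(1 / 2 : ℝ)) : ℝ) : ℂ)
    * (conj (a p.2) * (((p.2 : ℝ) ^ (-(1 / 2 : ℝ)) : ℝ) : ℂ)) with hc
  set fr : ℕ × ℕ → ℝ := fun p => Real.log p.2 - Real.log p.1 with hfr
  -- pointwise expansion of `|M|²`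
  have hexp : ∀ t : ℝ, (((‖Mt a N t‖ ^ 2 : ℝ)) : ℂ) = ∑ p ∈ S, c p * cexp (I * fr p * t) := by
    intro t
    rw [← Complex.normSq_eq_norm_sq, ← Complex.mul_conj, conj_Mt_eq_sum, Mt_eq_sum,
      Finset.sum_mul_sum, hS, Finset.sum_product]
    refine Finset.sum_congr rfl fun k _ => Finset.sum_congr rfl fun h _ => ?_
    simp only [hc, hfr]
    have : cexp (I * ((-Real.log k : ℝ) : ℂ) * (t : ℂ)) * cexp (I * ((Real.log h : ℝ) : ℂ) * (t : ℂ))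
        = cexp (I * ((Real.log h - Real.log k : ℝ) : ℂ) * (t : ℂ)) := by
      rw [← Complex.exp_add]; congr 1; push_cast; ring
    calc a k * (((k : ℝ) ^ (-(1 / 2 : ℝ)) : ℝ) : ℂ) * cexp (I * ((-Real.log k : ℝ) : ℂ) * (t : ℂ))
          * (conj (a h) * (((h : ℝ) ^ (-(1 / 2 : ℝ)) : ℝ) : ℂ) * cexp (I * ((Real.log h : ℝ) : ℂ) * (t : ℂ)))
        = a k * (((k : ℝ) ^ (-(1 / 2 : ℝ)) : ℝ) : ℂ) * (conj (a h) * (((h : ℝ) ^ (-(1 / 2 : ℝ)) : ℝ) : ℂ))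
          * (cexp (I * ((-Real.log k : ℝ) : ℂ) * (t : ℂ)) * cexp (I * ((Real.log h : ℝ) : ℂ) * (t : ℂ))) := by
          ring
      _ = _ := by rw [this]
  -- frequencies: zero iff `h = k`, else `≥ 1/N`
  have hfr0 : ∀ p ∈ S, fr p = 0 ↔ p.1 = p.2 := by
    intro p hp
    rw [hS, Finset.mem_product, Finset.mem_Icc, Finset.mem_Icc] at hp
    have h1 : (0 : ℝ) < p.1 := by exact_mod_cast hp.1.1
    have h2 : (0 : ℝ) < p.2 := by exact_mod_cast hp.2.1
    simp only [hfr, sub_eq_zero]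
    constructor
    · intro h
      have := Real.log_injOn_pos (Set.mem_Ioi.2 h2) (Set.mem_Ioi.2 h1) h
      exact_mod_cast this.symm
    · intro h; rw [h]
  have hsep : ∀ p ∈ S, fr p ≠ 0 → 1 / (N : ℝ) ≤ |fr p| := by
    intro p hp hne
    have hp' := hp
    rw [hS, Finset.mem_product, Finset.mem_Icc, Finset.mem_Icc] at hp'
    have hne' : p.2 ≠ p.1 := fun h => hne ((hfr0 p hp).2 h.symm)
    exact abs_log_sub_log_ge_inv hp'.2.1 hp'.1.1 hne' (by exact_mod_cast hp'.2.2)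
      (by exact_mod_cast hp'.1.2)
  have hNpos : (0 : ℝ) < N := by exact_mod_cast hN
  have hgen := norm_integral_window_expSum_sub_le' S c fr hH hHT k (μ₀ := 1 / N) (by positivity) hsep
  -- identify the two sides
  have hint_eq : (∫ t, dyadicWindow T H t * (((‖Mt a N t‖ ^ 2 : ℝ)) : ℂ))
      = ∫ t, dyadicWindow T H t * ∑ p ∈ S, c p * cexp (I * fr p * t) := by
    refine integral_congr_ae (Filter.Eventually.of_forall fun t => ?_); simp only [hexp t]
  have hdiag : ∑ p ∈ S.filter (fun p => fr p = 0), c p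
      = ∑ k ∈ Finset.Icc 1 N, (((‖a k‖ ^ 2 / k : ℝ)) : ℂ) := by
    rw [Finset.sum_filter, hS, Finset.sum_product]
    refine Finset.sum_congr rfl fun k hk => ?_
    have hk0 : (0 : ℝ) < k := by exact_mod_cast (Finset.mem_Icc.1 hk).1
    have hmem : ∀ h ∈ Finset.Icc 1 N, (fr (k, h) = 0 ↔ k = h) := fun h hh =>
      hfr0 (k, h) (by rw [hS]; exact Finset.mem_product.2 ⟨hk, hh⟩)
    rw [Finset.sum_congr rfl fun h hh => by rw [if_congr (hmem h hh) rfl rfl], Finset.sum_ite_eq]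
    rw [if_pos hk]
    simp only [hc]
    -- `a k k^{-1/2} conj(a k) k^{-1/2} = |a k|²/k`
    have hkk : (((k : ℝ) ^ (-(1 / 2 : ℝ)) : ℝ) : ℂ) * (((k : ℝ) ^ (-(1 / 2 : ℝ)) : ℝ) : ℂ) = ((k : ℝ)⁻¹ : ℝ) := by
      rw [← Complex.ofReal_mul, ← Real.rpow_add hk0]; norm_num [Real.rpow_neg_one]
    calc a k * (((k : ℝ) ^ (-(1 / 2 : ℝ)) : ℝ) : ℂ) * (conj (a k) * (((k : ℝ) ^ (-(1 / 2 : ℝ)) : ℝ) : ℂ))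
        = (a k * conj (a k)) * ((((k : ℝ) ^ (-(1 / 2 : ℝ)) : ℝ) : ℂ) * (((k : ℝ) ^ (-(1 / 2 : ℝ)) : ℝ) : ℂ)) := by
          ring
      _ = (((‖a k‖ ^ 2 / k : ℝ)) : ℂ) := by
          rw [hkk, Complex.mul_conj, Complex.normSq_eq_norm_sq]; push_cast; ring
  have hcsum : ∑ p ∈ S, ‖c p‖ = (∑ k ∈ Finset.Icc 1 N, ‖a k‖ * (k : ℝ) ^ (-(1 / 2 : ℝ))) ^ 2 := by
    rw [sq, Finset.sum_mul_sum, hS, Finset.sum_product]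
    refine Finset.sum_congr rfl fun k hk => Finset.sum_congr rfl fun h hh => ?_
    have hk0 : (0 : ℝ) < k := by exact_mod_cast (Finset.mem_Icc.1 hk).1
    have hh0 : (0 : ℝ) < h := by exact_mod_cast (Finset.mem_Icc.1 hh).1
    simp only [hc, norm_mul, Complex.norm_real, Real.norm_eq_abs, Complex.norm_conj,
      abs_of_nonneg (Real.rpow_nonneg hk0.le _), abs_of_nonneg (Real.rpow_nonneg hh0.le _)]
  rw [hint_eq, ← hdiag, ← hcsum]
  exact hgen

/-! ### `∫ w ζ M`: the diagonal `a(1) ∫ w` and the off-diagonal terms -/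

/-- `ζ(1/2+it)` is continuous in `t`. [folklore] -/
theorem continuous_zeta_half_line : Continuous fun t : ℝ => riemannZeta (1 / 2 + t * I) := by
  have hs : ∀ t : ℝ, (1 / 2 + (t : ℂ) * I) ≠ 1 := by
    intro t h
    have := congrArg Complex.re h
    norm_num at this
  have heq : (fun t : ℝ => riemannZeta (1 / 2 + t * I)) = riemannZeta ∘ fun t : ℝ => (1 / 2 : ℂ) + t * I := rfl
  rw [heq]
  refine continuous_iff_continuousAt.2 fun t => ?_
  exact ContinuousAt.comp (f := fun t : ℝ => (1 / 2 : ℂ) + t * I) (x := t)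
    (differentiableAt_riemannZeta (hs t)).continuousAt
    (by fun_prop : Continuous fun t : ℝ => (1 / 2 : ℂ) + t * I).continuousAt

/-- **The windowed first moment `∫ w ζ M`.** For `1 ≤ H ≤ T`, `T ≥ 1`, `N ≥ 1`, every `k`, and
`|a(n)| ≤ C_a` (`n ≤ N`):
`‖∫ w ζ(1/2+it) M(t) dt − a(1) ∫ w‖ ≤ 2√L_T (∑_{k≤N}|a(k)|k^{-1/2}) C_k T (H log 2)^{-k} + 24 C_a √N T^{3/4}`
(the Euler–Maclaurin sum `∑_{ℓ ≤ L_T} ℓ^{-s}` against `M`: frequencies `−log(ℓk)`, resonant only at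
`ℓ = k = 1`; the Euler–Maclaurin remainder `O(T^{-1/4})` against `|M| ≤ 2C_a√N` trivially).
[cite: Titchmarsh1986, §7.2] -/
theorem norm_integral_window_zeta_Mt_sub_le (a : ℕ → ℂ) {N : ℕ} (hN : 1 ≤ N) {T H : ℝ}
    (hH : 1 ≤ H) (hHT : H ≤ T) (k : ℕ) {Ca : ℝ} (hCa : ∀ n ∈ Finset.Icc 1 N, ‖a n‖ ≤ Ca) :
    ‖(∫ t, dyadicWindow T H t * (riemannZeta (1 / 2 + t * I) * Mt a N t))
        - a 1 * ∫ t, dyadicWindow T H t‖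
      ≤ 2 * Real.sqrt (emLen T) * (∑ k ∈ Finset.Icc 1 N, ‖a k‖ * (k : ℝ) ^ (-(1 / 2 : ℝ)))
            * (oscDecayConst k * T / (H * Real.log 2) ^ k)
          + 24 * Ca * Real.sqrt N * T ^ (3 / 4 : ℝ) := by
  have hT : 1 ≤ T := hH.trans hHT
  have hT0 : 0 < T := by linarith
  have hH0 : 0 < H := by linarith
  have hCa0 : 0 ≤ Ca := (norm_nonneg _).trans (hCa 1 (Finset.mem_Icc.2 ⟨le_rfl, hN⟩))
  set L : ℕ := emLen T with hL
  set w := dyadicWindow T H with hw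
  set ZL : ℝ → ℂ := fun t => ∑ n ∈ Finset.Icc 1 L, (n : ℂ) ^ (-(1 / 2 + t * I)) with hZL
  set Rem : ℝ → ℂ := fun t => riemannZeta (1 / 2 + t * I) - ZL t with hRem
  -- split `ζ M = Z_L M + Rem M`
  have hZLterm : ∀ {n : ℕ}, 0 < n → ∀ t : ℝ, (n : ℂ) ^ (-(1 / 2 + t * I))
      = (((n : ℝ) ^ (-(1 / 2 : ℝ)) : ℝ) : ℂ) * cexp (I * ((-Real.log n : ℝ) : ℂ) * (t : ℂ)) := by
    intro n hn t
    have := mollifier_term_eq hn (fun _ => (1 : ℂ)) t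
    simpa only [one_mul] using this
  have hZLcont : Continuous ZL := by
    have : ZL = fun t : ℝ => ∑ n ∈ Finset.Icc 1 L,
        (((n : ℝ) ^ (-(1 / 2 : ℝ)) : ℝ) : ℂ) * cexp (I * ((-Real.log n : ℝ) : ℂ) * (t : ℂ)) := by
      funext t
      exact Finset.sum_congr rfl fun n hn => hZLterm (Finset.mem_Icc.1 hn).1 t
    rw [this]
    exact continuous_finsetSum _ fun n _ => by fun_prop
  have hRemcont : Continuous Rem := continuous_zeta_half_line.sub hZLcont
  have hint1 : Integrable fun t => w t * (ZL t * Mt a N t) :=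
    integrable_dyadicWindow_mul hH0 hHT (hZLcont.mul (continuous_Mt a N))
  have hint2 : Integrable fun t => w t * (Rem t * Mt a N t) :=
    integrable_dyadicWindow_mul hH0 hHT (hRemcont.mul (continuous_Mt a N))
  have hsplit : (∫ t, w t * (riemannZeta (1 / 2 + t * I) * Mt a N t))
      = (∫ t, w t * (ZL t * Mt a N t)) + ∫ t, w t * (Rem t * Mt a N t) := by
    rw [← integral_add hint1 hint2]
    refine integral_congr_ae (Filter.Eventually.of_forall fun t => ?_)
    simp only [hRem]; ring
  -- the main part via the generic lemma on `Icc 1 L × Icc 1 N`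
  set S : Finset (ℕ × ℕ) := Finset.Icc 1 L ×ˢ Finset.Icc 1 N with hS
  set c : ℕ × ℕ → ℂ := fun p => (((p.1 : ℝ) ^ (-(1 / 2 : ℝ)) : ℝ) : ℂ)
    * (a p.2 * (((p.2 : ℝ) ^ (-(1 / 2 : ℝ)) : ℝ) : ℂ)) with hc
  set fr : ℕ × ℕ → ℝ := fun p => -Real.log p.1 + -Real.log p.2 with hfr
  have hexp : ∀ t : ℝ, ZL t * Mt a N t = ∑ p ∈ S, c p * cexp (I * fr p * t) := by
    intro t
    rw [hZL, Mt_eq_sum, Finset.sum_mul_sum, hS, Finset.sum_product]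
    refine Finset.sum_congr rfl fun ℓ hℓ => Finset.sum_congr rfl fun k _ => ?_
    have hℓ0 := (Finset.mem_Icc.1 hℓ).1
    rw [hZLterm hℓ0 t]
    simp only [hc, hfr]
    have : cexp (I * ((-Real.log ℓ : ℝ) : ℂ) * (t : ℂ)) * cexp (I * ((-Real.log k : ℝ) : ℂ) * (t : ℂ))
        = cexp (I * ((-Real.log ℓ + -Real.log k : ℝ) : ℂ) * (t : ℂ)) := by
      rw [← Complex.exp_add]; congr 1; push_cast; ring
    calc (((ℓ : ℝ) ^ (-(1 / 2 : ℝ)) : ℝ) : ℂ) * cexp (I * ((-Real.log ℓ : ℝ) : ℂ) * (t : ℂ))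
          * (a k * (((k : ℝ) ^ (-(1 / 2 : ℝ)) : ℝ) : ℂ) * cexp (I * ((-Real.log k : ℝ) : ℂ) * (t : ℂ)))
        = (((ℓ : ℝ) ^ (-(1 / 2 : ℝ)) : ℝ) : ℂ) * (a k * (((k : ℝ) ^ (-(1 / 2 : ℝ)) : ℝ) : ℂ))
          * (cexp (I * ((-Real.log ℓ : ℝ) : ℂ) * (t : ℂ)) * cexp (I * ((-Real.log k : ℝ) : ℂ) * (t : ℂ))) := by
          ring
      _ = _ := by rw [this]
  -- frequencies: zero iff `ℓ = k = 1`; else `≥ log 2`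
  have hfr0 : ∀ p ∈ S, fr p = 0 ↔ p = (1, 1) := by
    intro p hp
    rw [hS, Finset.mem_product, Finset.mem_Icc, Finset.mem_Icc] at hp
    have h1 : (1 : ℝ) ≤ p.1 := by exact_mod_cast hp.1.1
    have h2 : (1 : ℝ) ≤ p.2 := by exact_mod_cast hp.2.1
    have hl1 := Real.log_nonneg h1
    have hl2 := Real.log_nonneg h2
    simp only [hfr]
    constructor
    · intro h
      have e1 : Real.log p.1 = 0 := by linarith
      have e2 : Real.log p.2 = 0 := by linarith
      have q1 : (p.1 : ℝ) = 1 := by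
        rcases Real.log_eq_zero.1 e1 with h | h | h <;> linarith
      have q2 : (p.2 : ℝ) = 1 := by
        rcases Real.log_eq_zero.1 e2 with h | h | h <;> linarith
      ext <;> simp_all
    · rintro rfl; simp
  have hsep : ∀ p ∈ S, fr p ≠ 0 → Real.log 2 ≤ |fr p| := by
    intro p hp hne
    have hp' := hp
    rw [hS, Finset.mem_product, Finset.mem_Icc, Finset.mem_Icc] at hp'
    have h1 : (1 : ℝ) ≤ p.1 := by exact_mod_cast hp'.1.1
    have h2 : (1 : ℝ) ≤ p.2 := by exact_mod_cast hp'.2.1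
    -- `ℓ k ≥ 2`
    have hprod : (2 : ℝ) ≤ (p.1 : ℝ) * p.2 := by
      have : p ≠ (1, 1) := fun h => hne ((hfr0 p hp).2 h)
      have : 2 ≤ p.1 * p.2 := by
        rcases Nat.lt_or_ge 1 p.1 with h | h
        · nlinarith [hp'.2.1]
        · have hp1 : p.1 = 1 := le_antisymm h hp'.1.1
          have hp2 : p.2 ≠ 1 := fun h2 => this (Prod.ext hp1 h2)
          have : 2 ≤ p.2 := by have := hp'.2.1; omega
          nlinarith
      exact_mod_cast this
    simp only [hfr]
    rw [show -Real.log p.1 + -Real.log p.2 = -(Real.log ((p.1 : ℝ) * p.2)) by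
      rw [Real.log_mul (by positivity) (by positivity)]; ring, abs_neg,
      abs_of_nonneg (Real.log_nonneg (by linarith))]
    exact Real.log_le_log (by norm_num) hprod
  have hgen := norm_integral_window_expSum_sub_le' S c fr hH hHT k (μ₀ := Real.log 2)
    (Real.log_pos (by norm_num)) hsep
  have hmain_eq : (∫ t, w t * (ZL t * Mt a N t)) = ∫ t, w t * ∑ p ∈ S, c p * cexp (I * fr p * t) := by
    refine integral_congr_ae (Filter.Eventually.of_forall fun t => ?_); simp only [hexp t]
  have hdiag : ∑ p ∈ S.filter (fun p => fr p = 0), c p = a 1 := by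
    have hmem : (1, 1) ∈ S := by
      rw [hS, Finset.mem_product, Finset.mem_Icc, Finset.mem_Icc]
      exact ⟨⟨le_rfl, Nat.one_le_iff_ne_zero.2 (by
        rw [hL, emLen_def]; intro h
        have h1 : T ^ (3 / 2 : ℝ) < 1 := Nat.floor_eq_zero.1 h
        have : (1 : ℝ) ≤ T ^ (3 / 2 : ℝ) := Real.one_le_rpow hT (by norm_num)
        linarith)⟩, ⟨le_rfl, hN⟩⟩
    have hfilt : S.filter (fun p => fr p = 0) = {(1, 1)} := by
      ext p
      simp only [Finset.mem_filter, Finset.mem_singleton]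
      constructor
      · rintro ⟨hp, h⟩; exact (hfr0 p hp).1 h
      · rintro rfl; exact ⟨hmem, (hfr0 _ hmem).2 rfl⟩
    rw [hfilt, Finset.sum_singleton]
    simp [hc]
  have hcsum : ∑ p ∈ S, ‖c p‖ ≤ 2 * Real.sqrt L * ∑ k ∈ Finset.Icc 1 N, ‖a k‖ * (k : ℝ) ^ (-(1 / 2 : ℝ)) := by
    have : ∑ p ∈ S, ‖c p‖ = (∑ ℓ ∈ Finset.Icc 1 L, (ℓ : ℝ) ^ (-(1 / 2 : ℝ)))
        * ∑ k ∈ Finset.Icc 1 N, ‖a k‖ * (k : ℝ) ^ (-(1 / 2 : ℝ)) := by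
      rw [Finset.sum_mul_sum, hS, Finset.sum_product]
      refine Finset.sum_congr rfl fun ℓ hℓ => Finset.sum_congr rfl fun k hk => ?_
      have hℓ0 : (0 : ℝ) < ℓ := by exact_mod_cast (Finset.mem_Icc.1 hℓ).1
      have hk0 : (0 : ℝ) < k := by exact_mod_cast (Finset.mem_Icc.1 hk).1
      simp only [hc, norm_mul, Complex.norm_real, Real.norm_eq_abs,
        abs_of_nonneg (Real.rpow_nonneg hℓ0.le _), abs_of_nonneg (Real.rpow_nonneg hk0.le _)]
    rw [this]
    refine mul_le_mul_of_nonneg_right (AFE.sum_Icc_rpow_neg_half_le L)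
      (Finset.sum_nonneg fun k _ => by positivity)
  -- the remainder part, trivially
  have hMbound : ∀ t, ‖Mt a N t‖ ≤ 2 * Ca * Real.sqrt N := by
    intro t
    refine (norm_Mt_le a N t).trans ?_
    calc ∑ k ∈ Finset.Icc 1 N, ‖a k‖ * (k : ℝ) ^ (-(1 / 2 : ℝ))
        ≤ ∑ k ∈ Finset.Icc 1 N, Ca * (k : ℝ) ^ (-(1 / 2 : ℝ)) :=
          Finset.sum_le_sum fun k hk => mul_le_mul_of_nonneg_right (hCa k hk) (by positivity)
      _ = Ca * ∑ k ∈ Finset.Icc 1 N, (k : ℝ) ^ (-(1 / 2 : ℝ)) := by rw [Finset.mul_sum]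
      _ ≤ Ca * (2 * Real.sqrt N) := mul_le_mul_of_nonneg_left (AFE.sum_Icc_rpow_neg_half_le N) hCa0
      _ = 2 * Ca * Real.sqrt N := by ring
  have hrem : ‖∫ t, w t * (Rem t * Mt a N t)‖ ≤ 24 * Ca * Real.sqrt N * T ^ (3 / 4 : ℝ) := by
    have hb := norm_integral_dyadicWindow_mul_le hH0 hHT (F := fun t => Rem t * Mt a N t)
      (B₀ := 12 * T ^ (-(1 / 4 : ℝ)) * (2 * Ca * Real.sqrt N)) (fun t ht => by
        rw [norm_mul]
        exact mul_le_mul (norm_zeta_half_sub_sum_le hT ht) (hMbound t) (norm_nonneg _) (by positivity))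
    refine hb.trans (le_of_eq ?_)
    rw [show T ^ (3 / 4 : ℝ) = T ^ (-(1 / 4 : ℝ)) * T by
      rw [← Real.rpow_add_one hT0.ne']; norm_num]
    ring
  -- assemble
  rw [hsplit, hmain_eq]
  calc ‖(∫ t, w t * ∑ p ∈ S, c p * cexp (I * fr p * t)) + (∫ t, w t * (Rem t * Mt a N t))
          - a 1 * ∫ t, w t‖
      = ‖((∫ t, w t * ∑ p ∈ S, c p * cexp (I * fr p * t))
            - (∑ p ∈ S.filter (fun p => fr p = 0), c p) * ∫ t, w t)
          + ∫ t, w t * (Rem t * Mt a N t)‖ := by rw [hdiag]; ring_nf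
    _ ≤ ‖(∫ t, w t * ∑ p ∈ S, c p * cexp (I * fr p * t))
            - (∑ p ∈ S.filter (fun p => fr p = 0), c p) * ∫ t, w t‖
          + ‖∫ t, w t * (Rem t * Mt a N t)‖ := norm_add_le _ _
    _ ≤ (∑ p ∈ S, ‖c p‖) * (oscDecayConst k * T / (H * Real.log 2) ^ k)
          + 24 * Ca * Real.sqrt N * T ^ (3 / 4 : ℝ) := add_le_add hgen hrem
    _ ≤ 2 * Real.sqrt L * (∑ k ∈ Finset.Icc 1 N, ‖a k‖ * (k : ℝ) ^ (-(1 / 2 : ℝ)))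
            * (oscDecayConst k * T / (H * Real.log 2) ^ k)
          + 24 * Ca * Real.sqrt N * T ^ (3 / 4 : ℝ) := by
        have h0 : 0 ≤ oscDecayConst k * T / (H * Real.log 2) ^ k := by
          have := oscDecayConst_nonneg k
          have := Real.log_pos (by norm_num : (1 : ℝ) < 2)
          positivity
        nlinarith [mul_le_mul_of_nonneg_right hcsum h0]


/-! ### The smoothed main sum on the support of the window -/

/-- The smooth profile `t ↦ R_κ(t/(2πn²))` of the weight `ρ_n`. [folklore] -/
abbrev prof (κ : ℝ) (n : ℕ) : ℝ → ℂ := fun u => cutoffR κ ((2 * π * (n : ℝ) ^ 2)⁻¹ * u)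

/-- `S(t) = ∑_n R_κ(t/(2πn²)) n^{-1/2} e^{i(−log n)t}` for `t > 0`. [folklore] -/
theorem mainSum_eq_sum_prof {κ : ℝ} (hκ : 0 < κ) (Ns : ℕ) {t : ℝ} (ht : 0 < t) :
    mainSum κ Ns t = ∑ n ∈ Finset.Icc 1 Ns,
      prof κ n t * (((n : ℝ) ^ (-(1 / 2 : ℝ)) : ℝ) : ℂ) * cexp (I * ((-Real.log n : ℝ) : ℂ) * (t : ℂ)) := by
  rw [mainSum_def]
  refine Finset.sum_congr rfl fun n hn => ?_
  have hn := (Finset.mem_Icc.1 hn).1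
  rw [weight_eq_cutoffR hκ hn ht]
  have := mollifier_term_eq hn (fun _ => (1 : ℂ)) t
  simp only [one_mul] at this
  rw [show (-(1 / 2 : ℂ) - t * I) = -(1 / 2 + t * I) by ring, this, ← mul_assoc]

/-- `conj S(t) = ∑_n R_κ(t/(2πn²)) n^{-1/2} e^{i(log n)t}` for `t > 0`. [folklore] -/
theorem conj_mainSum_eq_sum_prof {κ : ℝ} (hκ : 0 < κ) (Ns : ℕ) {t : ℝ} (ht : 0 < t) :
    conj (mainSum κ Ns t) = ∑ n ∈ Finset.Icc 1 Ns,
      prof κ n t * (((n : ℝ) ^ (-(1 / 2 : ℝ)) : ℝ) : ℂ) * cexp (I * ((Real.log n : ℝ) : ℂ) * (t : ℂ)) := by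
  rw [conj_mainSum]
  refine Finset.sum_congr rfl fun n hn => ?_
  have hn := (Finset.mem_Icc.1 hn).1
  rw [weight_eq_cutoffR hκ hn ht]
  have := conj_mollifier_term_eq hn (fun _ => (1 : ℂ)) t
  simp only [map_one, one_mul] at this
  rw [show (-(1 / 2 : ℂ) + t * I) = conj (-(1 / 2 + t * I)) by
    apply Complex.ext <;> simp, ← conj_natCast_cpow, this, ← mul_assoc]

/-- `‖prof‖ ≤ 1`. [folklore] -/
theorem norm_prof_le_one (κ : ℝ) (n : ℕ) (u : ℝ) : ‖prof κ n u‖ ≤ 1 := norm_cutoffR_le_one _ _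

/-- `‖S(t)‖ ≤ 2√N_s` for `t > 0`. [folklore] -/
theorem norm_mainSum_le {κ : ℝ} (hκ : 0 < κ) (Ns : ℕ) {t : ℝ} (ht : 0 < t) :
    ‖mainSum κ Ns t‖ ≤ 2 * Real.sqrt Ns := by
  rw [mainSum_eq_sum_prof hκ Ns ht]
  refine (norm_sum_le _ _).trans ?_
  calc ∑ n ∈ Finset.Icc 1 Ns, ‖prof κ n t * (((n : ℝ) ^ (-(1 / 2 : ℝ)) : ℝ) : ℂ)
          * cexp (I * ((-Real.log n : ℝ) : ℂ) * (t : ℂ))‖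
      ≤ ∑ n ∈ Finset.Icc 1 Ns, (n : ℝ) ^ (-(1 / 2 : ℝ)) := by
        refine Finset.sum_le_sum fun n hn => ?_
        have hn0 : (0 : ℝ) < n := by exact_mod_cast (Finset.mem_Icc.1 hn).1
        rw [norm_mul, norm_mul, norm_cexp_I_mul_mul, mul_one, Complex.norm_real, Real.norm_eq_abs,
          abs_of_nonneg (by positivity)]
        exact mul_le_of_le_one_left (by positivity) (norm_prof_le_one κ n t)
    _ ≤ 2 * Real.sqrt Ns := AFE.sum_Icc_rpow_neg_half_le Ns

/-- **Leibniz bound for a product of two admissible amplitudes**: if `‖A_i^{(j)}‖ ≤ B_i/T^j` on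
`[T, 2T]` for `j ≤ k` (`i = 1, 2`), then `‖(A₁A₂)^{(j)}‖ ≤ 2^k B₁ B₂/T^j` there. [folklore] -/
theorem norm_iteratedDeriv_mul_le_of_bounds {A₁ A₂ : ℝ → ℂ} (h₁ : ContDiff ℝ ∞ A₁) (h₂ : ContDiff ℝ ∞ A₂)
    {k : ℕ} {B₁ B₂ T : ℝ} (hB₁ : 0 ≤ B₁) (hB₂ : 0 ≤ B₂) (hT : 1 ≤ T)
    (hA₁ : ∀ j ≤ k, ∀ t ∈ Set.Icc T (2 * T), ‖iteratedDeriv j A₁ t‖ ≤ B₁ / T ^ j)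
    (hA₂ : ∀ j ≤ k, ∀ t ∈ Set.Icc T (2 * T), ‖iteratedDeriv j A₂ t‖ ≤ B₂ / T ^ j) :
    ∀ j ≤ k, ∀ t ∈ Set.Icc T (2 * T),
      ‖iteratedDeriv j (fun u => A₁ u * A₂ u) t‖ ≤ 2 ^ k * B₁ * B₂ / T ^ j := by
  intro j hj t ht
  have hT0 : 0 < T := by linarith
  have hc1 : ContDiffAt ℝ j A₁ t := (h₁.of_le (by exact_mod_cast le_top)).contDiffAt
  have hc2 : ContDiffAt ℝ j A₂ t := (h₂.of_le (by exact_mod_cast le_top)).contDiffAt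
  rw [show (fun u => A₁ u * A₂ u) = A₁ * A₂ from rfl, iteratedDeriv_mul hc1 hc2]
  refine (norm_sum_le _ _).trans ?_
  have hterm : ∀ i ∈ Finset.range (j + 1),
      ‖(j.choose i : ℂ) * iteratedDeriv i A₁ t * iteratedDeriv (j - i) A₂ t‖
        ≤ (j.choose i : ℝ) * (B₁ * B₂ / T ^ j) := by
    intro i hi
    have hij : i ≤ j := Nat.lt_succ_iff.1 (Finset.mem_range.1 hi)
    rw [norm_mul, norm_mul, Complex.norm_natCast]
    have e1 := hA₁ i (hij.trans hj) t ht
    have e2 := hA₂ (j - i) ((Nat.sub_le j i).trans hj) t ht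
    have : B₁ / T ^ i * (B₂ / T ^ (j - i)) = B₁ * B₂ / T ^ j := by
      rw [div_mul_div_comm, ← pow_add, Nat.add_sub_cancel' hij]
    calc (j.choose i : ℝ) * ‖iteratedDeriv i A₁ t‖ * ‖iteratedDeriv (j - i) A₂ t‖
        ≤ (j.choose i : ℝ) * (B₁ / T ^ i) * (B₂ / T ^ (j - i)) := by gcongr
      _ = (j.choose i : ℝ) * (B₁ * B₂ / T ^ j) := by rw [mul_assoc, this]
  refine (Finset.sum_le_sum hterm).trans ?_
  rw [← Finset.sum_mul]
  have hsum : ∑ i ∈ Finset.range (j + 1), (j.choose i : ℝ) = 2 ^ j := by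
    have := Nat.sum_range_choose j
    exact_mod_cast this
  rw [hsum]
  have h2 : (2 : ℝ) ^ j ≤ 2 ^ k := pow_le_pow_right₀ (by norm_num) hj
  have : (0 : ℝ) ≤ B₁ * B₂ / T ^ j := by positivity
  calc (2 : ℝ) ^ j * (B₁ * B₂ / T ^ j) ≤ 2 ^ k * (B₁ * B₂ / T ^ j) :=
        mul_le_mul_of_nonneg_right h2 this
    _ = 2 ^ k * B₁ * B₂ / T ^ j := by ring

/-- `‖∫ w A‖ ≤ T` for an amplitude bounded by `1` on `[T, 2T]` (`0 < H ≤ T`). [folklore] -/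
theorem norm_integral_dyadicWindow_mul_le_T {T H : ℝ} (hH : 0 < H) (hHT : H ≤ T) {A : ℝ → ℂ}
    (hA : ∀ t ∈ Set.Icc T (2 * T), ‖A t‖ ≤ 1) : ‖∫ t, dyadicWindow T H t * A t‖ ≤ T := by
  have := norm_integral_dyadicWindow_mul_le hH hHT (F := A) (B₀ := 1) hA
  simpa using this

/-! ### `∫ w |S M|²`: an upper bound -/

/-- **The windowed mean square of `S M`: an upper bound.** For `1 ≤ H ≤ T`, `N, N_s ≥ 1`,
`κ > 0`, and with `B` the derivative constant of the profile (`norm_iteratedDeriv_weightProfile_le`):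
`‖∫ w |S M|²‖ ≤ T (∑_{n ≤ N_s} 1/n)(∑_{k≤N} |a(k)|/k)(∑_{k≤N}|a(k)|)`
`  + 4 N_s (∑_{k≤N} |a(k)| k^{-1/2})² · C_k 2^k B² T (H/(2 N_s N))^{-k}`
(resonant quadruples `n k = n' k'`: for each `(n, k, k')` at most one `n'`, and then the coefficient
is `|a(k) a(k')|/(nk)`; the other frequencies are `≥ 1/(2 N_s N)`). [cite: Titchmarsh1986, §7.2] -/
theorem norm_integral_window_normSq_SMt_le (a : ℕ → ℂ) {N Ns : ℕ} (hN : 1 ≤ N) (hNs : 1 ≤ Ns)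
    {κ : ℝ} (hκ : 0 < κ) {T H : ℝ} (hH : 1 ≤ H) (hHT : H ≤ T) (k : ℕ) {B : ℝ} (hB : 0 ≤ B)
    (hBρ : ∀ n : ℕ, 1 ≤ n → ∀ j ≤ k, ∀ t : ℝ, T ≤ t →
      ‖iteratedDeriv j (prof κ n) t‖ ≤ B / T ^ j) :
    ‖∫ t, dyadicWindow T H t * (((‖mainSum κ Ns t * Mt a N t‖ ^ 2 : ℝ)) : ℂ)‖
      ≤ T * ((∑ n ∈ Finset.Icc 1 Ns, (1 : ℝ) / n) * (∑ k ∈ Finset.Icc 1 N, ‖a k‖ / k)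
              * ∑ k ∈ Finset.Icc 1 N, ‖a k‖)
        + 4 * Ns * (∑ k ∈ Finset.Icc 1 N, ‖a k‖ * (k : ℝ) ^ (-(1 / 2 : ℝ))) ^ 2
            * (oscDecayConst k * (2 ^ k * B * B) * T / (H * (1 / (2 * (Ns : ℝ) * N))) ^ k) := by
  have hT : 1 ≤ T := hH.trans hHT
  have hT0 : 0 < T := by linarith
  have hH0 : 0 < H := by linarith
  set w := dyadicWindow T H with hw
  -- index set `(n, k, n', k')`
  set S4 : Finset ((ℕ × ℕ) × (ℕ × ℕ)) :=
    (Finset.Icc 1 Ns ×ˢ Finset.Icc 1 N) ×ˢ (Finset.Icc 1 Ns ×ˢ Finset.Icc 1 N) with hS4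
  set cf : ℕ × ℕ → ℂ := fun p => a p.2 * ((((p.1 : ℝ) ^ (-(1 / 2 : ℝ)) : ℝ) : ℂ)
    * (((p.2 : ℝ) ^ (-(1 / 2 : ℝ)) : ℝ) : ℂ)) with hcf
  set c : (ℕ × ℕ) × (ℕ × ℕ) → ℂ := fun q => cf q.1 * conj (cf q.2) with hc
  set fr : (ℕ × ℕ) × (ℕ × ℕ) → ℝ := fun q =>
    (Real.log q.2.1 + Real.log q.2.2) - (Real.log q.1.1 + Real.log q.1.2) with hfr
  set A : (ℕ × ℕ) × (ℕ × ℕ) → ℝ → ℂ := fun q u => prof κ q.1.1 u * prof κ q.2.1 u with hA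
  -- pointwise expansion on `t > 0`
  have hSM : ∀ t : ℝ, 0 < t → mainSum κ Ns t * Mt a N t
      = ∑ p ∈ Finset.Icc 1 Ns ×ˢ Finset.Icc 1 N, prof κ p.1 t * cf p
          * cexp (I * ((-(Real.log p.1 + Real.log p.2) : ℝ) : ℂ) * (t : ℂ)) := by
    intro t ht
    rw [mainSum_eq_sum_prof hκ Ns ht, Mt_eq_sum, Finset.sum_mul_sum, Finset.sum_product]
    refine Finset.sum_congr rfl fun n _ => Finset.sum_congr rfl fun k _ => ?_
    simp only [hcf]
    have : cexp (I * ((-Real.log n : ℝ) : ℂ) * (t : ℂ)) * cexp (I * ((-Real.log k : ℝ) : ℂ) * (t : ℂ))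
        = cexp (I * ((-(Real.log n + Real.log k) : ℝ) : ℂ) * (t : ℂ)) := by
      rw [← Complex.exp_add]; congr 1; push_cast; ring
    calc prof κ n t * (((n : ℝ) ^ (-(1 / 2 : ℝ)) : ℝ) : ℂ) * cexp (I * ((-Real.log n : ℝ) : ℂ) * (t : ℂ))
          * (a k * (((k : ℝ) ^ (-(1 / 2 : ℝ)) : ℝ) : ℂ) * cexp (I * ((-Real.log k : ℝ) : ℂ) * (t : ℂ)))
        = prof κ n t * (a k * ((((n : ℝ) ^ (-(1 / 2 : ℝ)) : ℝ) : ℂ) * (((k : ℝ) ^ (-(1 / 2 : ℝ)) : ℝ) : ℂ)))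
          * (cexp (I * ((-Real.log n : ℝ) : ℂ) * (t : ℂ)) * cexp (I * ((-Real.log k : ℝ) : ℂ) * (t : ℂ))) := by
          ring
      _ = _ := by rw [this]
  have hprof_real : ∀ n (u : ℝ), conj (prof κ n u) = prof κ n u := by
    intro n u
    simp only [prof, cutoffR_def]
    split_ifs <;> simp [Complex.conj_ofReal]
  have hexp : ∀ t : ℝ, 0 < t → ((((‖mainSum κ Ns t * Mt a N t‖ ^ 2 : ℝ)) : ℂ))
      = ∑ q ∈ S4, c q * A q t * cexp (I * fr q * t) := by
    intro t ht
    rw [← Complex.normSq_eq_norm_sq, ← Complex.mul_conj, hSM t ht]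
    simp only [map_sum]
    rw [Finset.sum_mul_sum]
    conv_rhs => rw [hS4, Finset.sum_product]
    refine Finset.sum_congr rfl fun p _ => Finset.sum_congr rfl fun p' _ => ?_
    simp only [hc, hA, hfr, map_mul, hprof_real, ← Complex.exp_conj, Complex.conj_I, Complex.conj_ofReal]
    have : cexp (I * ((-(Real.log p.1 + Real.log p.2) : ℝ) : ℂ) * (t : ℂ))
        * cexp (-I * ((-(Real.log p'.1 + Real.log p'.2) : ℝ) : ℂ) * (t : ℂ))
        = cexp (I * (((Real.log p'.1 + Real.log p'.2) - (Real.log p.1 + Real.log p.2) : ℝ) : ℂ) * (t : ℂ)) := by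
      rw [← Complex.exp_add]; congr 1; push_cast; ring
    calc prof κ p.1 t * cf p * cexp (I * ((-(Real.log p.1 + Real.log p.2) : ℝ) : ℂ) * (t : ℂ))
          * (prof κ p'.1 t * conj (cf p') * cexp (-I * ((-(Real.log p'.1 + Real.log p'.2) : ℝ) : ℂ) * (t : ℂ)))
        = cf p * conj (cf p') * (prof κ p.1 t * prof κ p'.1 t)
          * (cexp (I * ((-(Real.log p.1 + Real.log p.2) : ℝ) : ℂ) * (t : ℂ))
            * cexp (-I * ((-(Real.log p'.1 + Real.log p'.2) : ℝ) : ℂ) * (t : ℂ))) := by ring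
      _ = _ := by rw [this]
  -- frequencies
  have hmemS4 : ∀ q ∈ S4, (1 ≤ q.1.1 ∧ q.1.1 ≤ Ns) ∧ (1 ≤ q.1.2 ∧ q.1.2 ≤ N)
      ∧ (1 ≤ q.2.1 ∧ q.2.1 ≤ Ns) ∧ (1 ≤ q.2.2 ∧ q.2.2 ≤ N) := by
    intro q hq
    simp only [hS4, Finset.mem_product, Finset.mem_Icc] at hq
    exact ⟨hq.1.1, hq.1.2, hq.2.1, hq.2.2⟩
  have hfr_eq : ∀ q ∈ S4, fr q = Real.log ((q.2.1 * q.2.2 : ℕ) : ℝ) - Real.log ((q.1.1 * q.1.2 : ℕ) : ℝ) := by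
    intro q hq
    obtain ⟨h1, h2, h3, h4⟩ := hmemS4 q hq
    have n1 : ((q.1.1 : ℕ) : ℝ) ≠ 0 := by exact_mod_cast (show q.1.1 ≠ 0 by omega)
    have n2 : ((q.1.2 : ℕ) : ℝ) ≠ 0 := by exact_mod_cast (show q.1.2 ≠ 0 by omega)
    have n3 : ((q.2.1 : ℕ) : ℝ) ≠ 0 := by exact_mod_cast (show q.2.1 ≠ 0 by omega)
    have n4 : ((q.2.2 : ℕ) : ℝ) ≠ 0 := by exact_mod_cast (show q.2.2 ≠ 0 by omega)
    simp only [hfr]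
    push_cast
    rw [Real.log_mul n3 n4, Real.log_mul n1 n2]
  have hfr0 : ∀ q ∈ S4, fr q = 0 ↔ q.1.1 * q.1.2 = q.2.1 * q.2.2 := by
    intro q hq
    obtain ⟨h1, h2, h3, h4⟩ := hmemS4 q hq
    rw [hfr_eq q hq, sub_eq_zero]
    constructor
    · intro h
      have hpos1 : (0 : ℝ) < ((q.2.1 * q.2.2 : ℕ) : ℝ) := Nat.cast_pos.2 (Nat.mul_pos h3.1 h4.1)
      have hpos2 : (0 : ℝ) < ((q.1.1 * q.1.2 : ℕ) : ℝ) := Nat.cast_pos.2 (Nat.mul_pos h1.1 h2.1)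
      have := Real.log_injOn_pos (Set.mem_Ioi.2 hpos1) (Set.mem_Ioi.2 hpos2) h
      exact_mod_cast this.symm
    · intro h; rw [h]
  have hYpos : (1 : ℝ) ≤ (Ns : ℝ) * N := by
    have : (1 : ℝ) ≤ Ns := by exact_mod_cast hNs
    have : (1 : ℝ) ≤ N := by exact_mod_cast hN
    nlinarith
  have hsep : ∀ q ∈ S4, fr q ≠ 0 → 1 / (2 * ((Ns : ℝ) * N)) ≤ |fr q| := by
    intro q hq hne
    obtain ⟨h1, h2, h3, h4⟩ := hmemS4 q hq
    rw [hfr_eq q hq]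
    have hne' : q.2.1 * q.2.2 ≠ q.1.1 * q.1.2 := fun h => hne ((hfr0 q hq).2 h.symm)
    refine abs_log_sub_log_ge_inv' (Nat.mul_pos h3.1 h4.1) (Nat.mul_pos h1.1 h2.1) hne' hYpos ?_
    push_cast
    exact mul_le_mul (by exact_mod_cast h1.2) (by exact_mod_cast h2.2) (by positivity) (by positivity)
  -- amplitudes
  have hAcd : ∀ q ∈ S4, ContDiff ℝ ∞ (A q) := fun q _ =>
    (contDiff_weightProfile hκ _).mul (contDiff_weightProfile hκ _)
  have hAB : ∀ q ∈ S4, ∀ j ≤ k, ∀ t ∈ Set.Icc T (2 * T),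
      ‖iteratedDeriv j (A q) t‖ ≤ (2 ^ k * B * B) / T ^ j := by
    intro q hq
    obtain ⟨h1, _, h3, _⟩ := hmemS4 q hq
    exact norm_iteratedDeriv_mul_le_of_bounds (contDiff_weightProfile hκ _) (contDiff_weightProfile hκ _)
      hB hB hT (fun j hj t ht => hBρ _ h1.1 j hj t ht.1) (fun j hj t ht => hBρ _ h3.1 j hj t ht.1)
  have hgen := norm_integral_window_expSum_sub_le S4 c fr A hH hHT k (by positivity)
    (by positivity : (0 : ℝ) < 1 / (2 * ((Ns : ℝ) * N))) hAcd hAB hsep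
  -- the integral equals the windowed exponential sum (on the support `t > 0`)
  have hint_eq : (∫ t, w t * (((‖mainSum κ Ns t * Mt a N t‖ ^ 2 : ℝ)) : ℂ))
      = ∫ t, w t * ∑ q ∈ S4, c q * A q t * cexp (I * fr q * t) := by
    refine integral_congr_ae (Filter.Eventually.of_forall fun t => ?_)
    rcases le_or_gt t 0 with ht | ht
    · have : w t = 0 := dyadicWindow_eq_zero_of_le hH0 hHT (by linarith)
      simp only [this, zero_mul]
    · simp only [hexp t ht]
  -- bound the resonant part
  have hres : ‖∑ q ∈ S4.filter (fun q => fr q = 0), c q * ∫ t, w t * A q t‖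
      ≤ T * ((∑ n ∈ Finset.Icc 1 Ns, (1 : ℝ) / n) * (∑ k ∈ Finset.Icc 1 N, ‖a k‖ / k)
              * ∑ k ∈ Finset.Icc 1 N, ‖a k‖) := by
    -- each integral is at most `T` in norm
    have hIA : ∀ q ∈ S4, ‖∫ t, w t * A q t‖ ≤ T := by
      intro q _
      refine norm_integral_dyadicWindow_mul_le_T hH0 hHT fun t _ => ?_
      simp only [hA, norm_mul]
      exact mul_le_one₀ (norm_prof_le_one _ _ _) (norm_nonneg _) (norm_prof_le_one _ _ _)
    calc ‖∑ q ∈ S4.filter (fun q => fr q = 0), c q * ∫ t, w t * A q t‖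
        ≤ ∑ q ∈ S4.filter (fun q => fr q = 0), ‖c q‖ * T := by
          refine (norm_sum_le _ _).trans (Finset.sum_le_sum fun q hq => ?_)
          rw [norm_mul]
          exact mul_le_mul_of_nonneg_left (hIA q (Finset.mem_filter.1 hq).1) (norm_nonneg _)
      _ = T * ∑ q ∈ S4.filter (fun q => fr q = 0), ‖c q‖ := by rw [← Finset.sum_mul, mul_comm]
      _ ≤ T * ((∑ n ∈ Finset.Icc 1 Ns, (1 : ℝ) / n) * (∑ k ∈ Finset.Icc 1 N, ‖a k‖ / k)
              * ∑ k ∈ Finset.Icc 1 N, ‖a k‖) := by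
          refine mul_le_mul_of_nonneg_left ?_ hT0.le
          -- `∑_{res} ‖c‖ ≤ ∑_{n,k,k'} |a k||a k'|/(nk)`
          rw [Finset.sum_filter, hS4, Finset.sum_product, Finset.sum_product]
          -- reorganise the target as a sum over `(n,k)` and `k'`
          have htarget : (∑ n ∈ Finset.Icc 1 Ns, (1 : ℝ) / n) * (∑ k ∈ Finset.Icc 1 N, ‖a k‖ / k)
              * ∑ k ∈ Finset.Icc 1 N, ‖a k‖
              = ∑ n ∈ Finset.Icc 1 Ns, ∑ k ∈ Finset.Icc 1 N, ∑ k' ∈ Finset.Icc 1 N,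
                  ‖a k‖ * ‖a k'‖ / (n * k) := by
            rw [Finset.sum_mul_sum, Finset.sum_mul]
            refine Finset.sum_congr rfl fun n _ => ?_
            rw [Finset.sum_mul]
            refine Finset.sum_congr rfl fun k _ => ?_
            rw [Finset.mul_sum]
            refine Finset.sum_congr rfl fun k' _ => ?_
            ring
          rw [htarget]
          refine Finset.sum_le_sum fun n hn => Finset.sum_le_sum fun k hk => ?_
          rw [Finset.sum_product]
          -- swap the order `n', k'` → `k', n'` and bound the inner sum over `n'`
          rw [Finset.sum_comm]
          refine Finset.sum_le_sum fun k' hk' => ?_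
          have hn0 : (0 : ℝ) < n := by exact_mod_cast (Finset.mem_Icc.1 hn).1
          have hk0 : (0 : ℝ) < k := by exact_mod_cast (Finset.mem_Icc.1 hk).1
          have hk'0 : (0 : ℝ) < k' := by exact_mod_cast (Finset.mem_Icc.1 hk').1
          have hk'pos : 0 < k' := (Finset.mem_Icc.1 hk').1
          -- the inner sum has at most one non-zero term, of size `|a k||a k'|/(nk)`
          have hval : ∀ n' ∈ Finset.Icc 1 Ns, (if fr ((n, k), (n', k')) = 0 then ‖c ((n, k), (n', k'))‖ else 0)
              ≤ if n * k = n' * k' then ‖a k‖ * ‖a k'‖ / (n * k) else 0 := by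
            intro n' hn'
            have hq : ((n, k), (n', k')) ∈ S4 := by
              rw [hS4]; exact Finset.mem_product.2 ⟨Finset.mem_product.2 ⟨hn, hk⟩, Finset.mem_product.2 ⟨hn', hk'⟩⟩
            rw [if_congr (hfr0 _ hq) rfl rfl]
            split_ifs with h
            · -- on the resonance `(n k n' k')^{-1/2} = 1/(nk)`
              have hn'0 : (0 : ℝ) < n' := by exact_mod_cast (Finset.mem_Icc.1 hn').1
              have hcast : (n : ℝ) * k = n' * k' := by exact_mod_cast h
              simp only [hc, hcf, norm_mul, Complex.norm_conj, Complex.norm_real, Real.norm_eq_abs,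
                abs_of_nonneg (Real.rpow_nonneg hn0.le _), abs_of_nonneg (Real.rpow_nonneg hk0.le _),
                abs_of_nonneg (Real.rpow_nonneg hn'0.le _), abs_of_nonneg (Real.rpow_nonneg hk'0.le _)]
              have hprod : (n : ℝ) ^ (-(1 / 2 : ℝ)) * (k : ℝ) ^ (-(1 / 2 : ℝ))
                  * ((n' : ℝ) ^ (-(1 / 2 : ℝ)) * (k' : ℝ) ^ (-(1 / 2 : ℝ))) = 1 / (n * k) := by
                rw [← Real.mul_rpow hn0.le hk0.le, ← Real.mul_rpow hn'0.le hk'0.le, ← hcast,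
                  ← Real.rpow_add (by positivity)]
                norm_num
                rw [Real.rpow_neg_one]; ring
              calc ‖a k‖ * ((n : ℝ) ^ (-(1 / 2 : ℝ)) * (k : ℝ) ^ (-(1 / 2 : ℝ)))
                    * (‖a k'‖ * ((n' : ℝ) ^ (-(1 / 2 : ℝ)) * (k' : ℝ) ^ (-(1 / 2 : ℝ))))
                  = ‖a k‖ * ‖a k'‖ * ((n : ℝ) ^ (-(1 / 2 : ℝ)) * (k : ℝ) ^ (-(1 / 2 : ℝ))
                    * ((n' : ℝ) ^ (-(1 / 2 : ℝ)) * (k' : ℝ) ^ (-(1 / 2 : ℝ)))) := by ring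
                _ = ‖a k‖ * ‖a k'‖ / (n * k) := by rw [hprod]; ring
                _ ≤ _ := le_rfl
            · exact le_rfl
          refine (Finset.sum_le_sum hval).trans ?_
          -- at most one `n'` with `n' k' = n k`
          rw [← Finset.sum_filter]
          have hcard : (Finset.filter (fun n' => n * k = n' * k') (Finset.Icc 1 Ns)).card ≤ 1 := by
            refine Finset.card_le_one.2 fun x hx y hy => ?_
            rw [Finset.mem_filter] at hx hy
            have : x * k' = y * k' := by rw [← hx.2, ← hy.2]
            exact Nat.eq_of_mul_eq_mul_right hk'pos this
          have hnn : 0 ≤ ‖a k‖ * ‖a k'‖ / (n * k) := by positivity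
          calc ∑ n' ∈ Finset.filter (fun n' => n * k = n' * k') (Finset.Icc 1 Ns), ‖a k‖ * ‖a k'‖ / (n * k)
              = (Finset.filter (fun n' => n * k = n' * k') (Finset.Icc 1 Ns)).card • (‖a k‖ * ‖a k'‖ / (n * k)) :=
                Finset.sum_const _
            _ ≤ 1 • (‖a k‖ * ‖a k'‖ / (n * k)) := by
                rw [nsmul_eq_mul, nsmul_eq_mul]
                exact mul_le_mul_of_nonneg_right (by exact_mod_cast hcard) hnn
            _ = ‖a k‖ * ‖a k'‖ / (n * k) := one_nsmul _
  -- the coefficient sum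
  have hcsum : ∑ q ∈ S4, ‖c q‖ ≤ 4 * Ns * (∑ k ∈ Finset.Icc 1 N, ‖a k‖ * (k : ℝ) ^ (-(1 / 2 : ℝ))) ^ 2 := by
    have hcf_sum : ∑ p ∈ Finset.Icc 1 Ns ×ˢ Finset.Icc 1 N, ‖cf p‖
        = (∑ n ∈ Finset.Icc 1 Ns, (n : ℝ) ^ (-(1 / 2 : ℝ)))
          * ∑ k ∈ Finset.Icc 1 N, ‖a k‖ * (k : ℝ) ^ (-(1 / 2 : ℝ)) := by
      rw [Finset.sum_mul_sum, Finset.sum_product]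
      refine Finset.sum_congr rfl fun n hn => Finset.sum_congr rfl fun k hk => ?_
      have hn0 : (0 : ℝ) < n := by exact_mod_cast (Finset.mem_Icc.1 hn).1
      have hk0 : (0 : ℝ) < k := by exact_mod_cast (Finset.mem_Icc.1 hk).1
      simp only [hcf, norm_mul, Complex.norm_real, Real.norm_eq_abs,
        abs_of_nonneg (Real.rpow_nonneg hn0.le _), abs_of_nonneg (Real.rpow_nonneg hk0.le _)]
      ring
    have h1 : ∑ q ∈ S4, ‖c q‖ = (∑ p ∈ Finset.Icc 1 Ns ×ˢ Finset.Icc 1 N, ‖cf p‖) ^ 2 := by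
      rw [sq, Finset.sum_mul_sum, hS4, Finset.sum_product]
      refine Finset.sum_congr rfl fun p _ => Finset.sum_congr rfl fun p' _ => ?_
      simp only [hc, norm_mul, Complex.norm_conj]
    rw [h1, hcf_sum, mul_pow]
    have hs := AFE.sum_Icc_rpow_neg_half_le Ns
    have hs0 : 0 ≤ ∑ n ∈ Finset.Icc 1 Ns, (n : ℝ) ^ (-(1 / 2 : ℝ)) := Finset.sum_nonneg fun n _ => by positivity
    have hsq : (∑ n ∈ Finset.Icc 1 Ns, (n : ℝ) ^ (-(1 / 2 : ℝ))) ^ 2 ≤ 4 * Ns := by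
      calc (∑ n ∈ Finset.Icc 1 Ns, (n : ℝ) ^ (-(1 / 2 : ℝ))) ^ 2 ≤ (2 * Real.sqrt Ns) ^ 2 :=
            pow_le_pow_left₀ hs0 hs 2
        _ = 4 * Ns := by rw [mul_pow, Real.sq_sqrt (Nat.cast_nonneg _)]; ring
    exact mul_le_mul_of_nonneg_right hsq (by positivity)
  -- assemble
  rw [hint_eq]
  have hμ : (1 / (2 * ((Ns : ℝ) * N))) = 1 / (2 * (Ns : ℝ) * N) := by ring
  calc ‖∫ t, w t * ∑ q ∈ S4, c q * A q t * cexp (I * fr q * t)‖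
      = ‖(∑ q ∈ S4.filter (fun q => fr q = 0), c q * ∫ t, w t * A q t)
          + ((∫ t, w t * ∑ q ∈ S4, c q * A q t * cexp (I * fr q * t))
              - ∑ q ∈ S4.filter (fun q => fr q = 0), c q * ∫ t, w t * A q t)‖ := by ring_nf
    _ ≤ ‖∑ q ∈ S4.filter (fun q => fr q = 0), c q * ∫ t, w t * A q t‖
          + ‖(∫ t, w t * ∑ q ∈ S4, c q * A q t * cexp (I * fr q * t))
              - ∑ q ∈ S4.filter (fun q => fr q = 0), c q * ∫ t, w t * A q t‖ := norm_add_le _ _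
    _ ≤ T * ((∑ n ∈ Finset.Icc 1 Ns, (1 : ℝ) / n) * (∑ k ∈ Finset.Icc 1 N, ‖a k‖ / k)
              * ∑ k ∈ Finset.Icc 1 N, ‖a k‖)
          + (∑ q ∈ S4, ‖c q‖) * (oscDecayConst k * (2 ^ k * B * B) * T / (H * (1 / (2 * ((Ns : ℝ) * N)))) ^ k) :=
        add_le_add hres hgen
    _ ≤ _ := by
        rw [hμ]
        have h0 : 0 ≤ oscDecayConst k * (2 ^ k * B * B) * T / (H * (1 / (2 * (Ns : ℝ) * N))) ^ k := by
          have := oscDecayConst_nonneg k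
          positivity
        nlinarith [mul_le_mul_of_nonneg_right hcsum h0]


/-! ### `∫ w ζ S̄ M M̄`: the resonant part and the rest -/

/-- The index set of `∫ w Z_L S̄ M M̄`: quadruples `((ℓ, n), (k, h))`. [folklore] -/
def I2set (L Ns N : ℕ) : Finset ((ℕ × ℕ) × (ℕ × ℕ)) :=
  (Finset.Icc 1 L ×ˢ Finset.Icc 1 Ns) ×ˢ (Finset.Icc 1 N ×ˢ Finset.Icc 1 N)

/-- The coefficient `a(k) conj a(h) (ℓ n k h)^{-1/2}` of the quadruple `((ℓ,n),(k,h))`. [folklore] -/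
def I2coef (a : ℕ → ℂ) (q : (ℕ × ℕ) × (ℕ × ℕ)) : ℂ :=
  ((((q.1.1 : ℝ) ^ (-(1 / 2 : ℝ)) : ℝ) : ℂ) * (((q.1.2 : ℝ) ^ (-(1 / 2 : ℝ)) : ℝ) : ℂ))
    * (a q.2.1 * (((q.2.1 : ℝ) ^ (-(1 / 2 : ℝ)) : ℝ) : ℂ)
      * (conj (a q.2.2) * (((q.2.2 : ℝ) ^ (-(1 / 2 : ℝ)) : ℝ) : ℂ)))

/-- The resonance condition `n h = ℓ k`. [folklore] -/
def I2res (q : (ℕ × ℕ) × (ℕ × ℕ)) : Prop := q.1.2 * q.2.2 = q.1.1 * q.2.1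

/-- The resonance condition is decidable (an equation in `ℕ`). [folklore] -/
instance I2res.decidable (q : (ℕ × ℕ) × (ℕ × ℕ)) : Decidable (I2res q) := by unfold I2res; infer_instance

/-- **The resonant part** `D₂ = ∑_{nh = ℓk} a(k) ā(h) (ℓnkh)^{-1/2} ∫ w(t) R_κ(t/(2πn²)) dt` of
`∫ w ζ S̄ M M̄`. [folklore] -/
def I2diag (a : ℕ → ℂ) (κ : ℝ) (L Ns N : ℕ) (T H : ℝ) : ℂ :=
  ∑ q ∈ (I2set L Ns N).filter (fun q => I2res q), I2coef a q * ∫ t, dyadicWindow T H t * prof κ q.1.2 t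

/-- `‖I2coef‖`. [folklore] -/
theorem norm_I2coef {a : ℕ → ℂ} {q : (ℕ × ℕ) × (ℕ × ℕ)} (h1 : 0 < q.1.1) (h2 : 0 < q.1.2)
    (h3 : 0 < q.2.1) (h4 : 0 < q.2.2) :
    ‖I2coef a q‖ = ((q.1.1 : ℝ) ^ (-(1 / 2 : ℝ)) * (q.1.2 : ℝ) ^ (-(1 / 2 : ℝ)))
      * ((‖a q.2.1‖ * (q.2.1 : ℝ) ^ (-(1 / 2 : ℝ))) * (‖a q.2.2‖ * (q.2.2 : ℝ) ^ (-(1 / 2 : ℝ)))) := by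
  have p1 : (0 : ℝ) < q.1.1 := by exact_mod_cast h1
  have p2 : (0 : ℝ) < q.1.2 := by exact_mod_cast h2
  have p3 : (0 : ℝ) < q.2.1 := by exact_mod_cast h3
  have p4 : (0 : ℝ) < q.2.2 := by exact_mod_cast h4
  simp only [I2coef, norm_mul, Complex.norm_real, Real.norm_eq_abs, Complex.norm_conj,
    abs_of_nonneg (Real.rpow_nonneg p1.le _), abs_of_nonneg (Real.rpow_nonneg p2.le _),
    abs_of_nonneg (Real.rpow_nonneg p3.le _), abs_of_nonneg (Real.rpow_nonneg p4.le _)]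

/-- AM–GM for the weighted integrand: `x y ≤ (ε x² + ε⁻¹ y²)/2` (`ε > 0`). [folklore] -/
theorem mul_le_amgm (x y : ℝ) {ε : ℝ} (hε : 0 < ε) :
    x * y ≤ (ε * x ^ 2 + ε⁻¹ * y ^ 2) / 2 := by
  have h : 0 ≤ (ε * x - y) ^ 2 := sq_nonneg _
  have hε' : ε * (x * y) * 2 ≤ ε * (ε * x ^ 2) + y ^ 2 := by nlinarith
  rw [le_div_iff₀ (by norm_num : (0 : ℝ) < 2)]
  have : ε * (ε * x ^ 2 + ε⁻¹ * y ^ 2) = ε * (ε * x ^ 2) + y ^ 2 := by field_simp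
  nlinarith [mul_le_mul_of_nonneg_left (le_of_eq this.symm) hε.le]

/-- **The windowed twisted first moment `∫ w ζ S̄ M M̄`.** For `1 ≤ H ≤ T`, `N, N_s ≥ 1`,
`κ > 0`, the profile derivative constant `B` (order `≤ k`), `|a(n)| ≤ C_a` and every `ε > 0`:
`‖∫ w(t) ζ(1/2+it) conj S(t) M(t) conj M(t) dt − D₂‖`
`  ≤ 4 √L_T √N_s (∑_{k≤N}|a(k)|k^{-1/2})² · C_k B T (H/(2N_sN))^{-k}`
`    + 12 T^{-1/4} (ε/2 ∫ w |S M|² + (2ε)⁻¹ ∫ w |M|²)`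
(frequencies `log(nh) − log(ℓk)`; the Euler–Maclaurin remainder against `|S M| |M|` by AM–GM).
[cite: Titchmarsh1986, §7.2] -/
theorem norm_integral_window_zeta_conjS_MM_sub_le (a : ℕ → ℂ) {N Ns : ℕ} (hN : 1 ≤ N) (hNs : 1 ≤ Ns)
    {κ : ℝ} (hκ : 0 < κ) {T H : ℝ} (hH : 1 ≤ H) (hHT : H ≤ T) (k : ℕ) {B : ℝ} (hB : 0 ≤ B)
    (hBρ : ∀ n : ℕ, 1 ≤ n → ∀ j ≤ k, ∀ t : ℝ, T ≤ t →
      ‖iteratedDeriv j (prof κ n) t‖ ≤ B / T ^ j) {ε : ℝ} (hε : 0 < ε)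
    (hintSM : Integrable fun t => dyadicWindowRe T H t * ‖mainSum κ Ns t * Mt a N t‖ ^ 2)
    (hintM : Integrable fun t => dyadicWindowRe T H t * ‖Mt a N t‖ ^ 2) :
    ‖(∫ t, dyadicWindow T H t *
          (riemannZeta (1 / 2 + t * I) * conj (mainSum κ Ns t) * Mt a N t * conj (Mt a N t)))
        - I2diag a κ (emLen T) Ns N T H‖
      ≤ 4 * Real.sqrt (emLen T) * Real.sqrt Ns
            * (∑ k ∈ Finset.Icc 1 N, ‖a k‖ * (k : ℝ) ^ (-(1 / 2 : ℝ))) ^ 2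
            * (oscDecayConst k * B * T / (H * (1 / (2 * (Ns : ℝ) * N))) ^ k)
        + 12 * T ^ (-(1 / 4 : ℝ)) * (ε / 2 * (∫ t, dyadicWindowRe T H t * ‖mainSum κ Ns t * Mt a N t‖ ^ 2)
            + ε⁻¹ / 2 * (∫ t, dyadicWindowRe T H t * ‖Mt a N t‖ ^ 2)) := by
  have hT : 1 ≤ T := hH.trans hHT
  have hT0 : 0 < T := by linarith
  have hH0 : 0 < H := by linarith
  set L : ℕ := emLen T with hL
  set w := dyadicWindow T H with hw
  set ZL : ℝ → ℂ := fun t => ∑ n ∈ Finset.Icc 1 L, (n : ℂ) ^ (-(1 / 2 + t * I)) with hZL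
  set Rem : ℝ → ℂ := fun t => riemannZeta (1 / 2 + t * I) - ZL t with hRem
  set F : ℝ → ℂ := fun t => conj (mainSum κ Ns t) * Mt a N t * conj (Mt a N t) with hF
  -- the prof-version of `F` (equal for `t > 0`, continuous everywhere)
  set Sp : ℝ → ℂ := fun t => ∑ n ∈ Finset.Icc 1 Ns,
      prof κ n t * (((n : ℝ) ^ (-(1 / 2 : ℝ)) : ℝ) : ℂ) * cexp (I * ((Real.log n : ℝ) : ℂ) * (t : ℂ)) with hSp
  have hSp_eq : ∀ t : ℝ, 0 < t → conj (mainSum κ Ns t) = Sp t := fun t ht => conj_mainSum_eq_sum_prof hκ Ns ht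
  have hSpcont : Continuous Sp := continuous_finsetSum _ fun n _ =>
    ((continuous_cutoffR hκ).comp (by fun_prop)).mul continuous_const |>.mul (by fun_prop)
  set Fp : ℝ → ℂ := fun t => Sp t * Mt a N t * conj (Mt a N t) with hFp
  have hFpcont : Continuous Fp :=
    (hSpcont.mul (continuous_Mt a N)).mul (Complex.continuous_conj.comp (continuous_Mt a N))
  have hwF : ∀ G : ℝ → ℂ, ∀ t : ℝ, w t * (G t * F t) = w t * (G t * Fp t) := by
    intro G t
    rcases le_or_gt t 0 with ht | ht
    · have : w t = 0 := dyadicWindow_eq_zero_of_le hH0 hHT (by linarith)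
      simp [this]
    · simp only [hF, hFp, hSp_eq t ht]
  -- `Z_L` and its continuity
  have hZLterm : ∀ {n : ℕ}, 0 < n → ∀ t : ℝ, (n : ℂ) ^ (-(1 / 2 + t * I))
      = (((n : ℝ) ^ (-(1 / 2 : ℝ)) : ℝ) : ℂ) * cexp (I * ((-Real.log n : ℝ) : ℂ) * (t : ℂ)) := by
    intro n hn t
    have := mollifier_term_eq hn (fun _ => (1 : ℂ)) t
    simpa only [one_mul] using this
  have hZLcont : Continuous ZL := by
    have : ZL = fun t : ℝ => ∑ n ∈ Finset.Icc 1 L,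
        (((n : ℝ) ^ (-(1 / 2 : ℝ)) : ℝ) : ℂ) * cexp (I * ((-Real.log n : ℝ) : ℂ) * (t : ℂ)) := by
      funext t; exact Finset.sum_congr rfl fun n hn => hZLterm (Finset.mem_Icc.1 hn).1 t
    rw [this]; exact continuous_finsetSum _ fun n _ => by fun_prop
  have hRemcont : Continuous Rem := continuous_zeta_half_line.sub hZLcont
  -- split `ζ F = Z_L Fp + Rem Fp` under the window
  have hint1 : Integrable fun t => w t * (ZL t * Fp t) := integrable_dyadicWindow_mul hH0 hHT (hZLcont.mul hFpcont)
  have hint2 : Integrable fun t => w t * (Rem t * Fp t) := integrable_dyadicWindow_mul hH0 hHT (hRemcont.mul hFpcont)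
  have hsplit : (∫ t, w t * (riemannZeta (1 / 2 + t * I) * conj (mainSum κ Ns t) * Mt a N t * conj (Mt a N t)))
      = (∫ t, w t * (ZL t * Fp t)) + ∫ t, w t * (Rem t * Fp t) := by
    rw [← integral_add hint1 hint2]
    refine integral_congr_ae (Filter.Eventually.of_forall fun t => ?_)
    show w t * (riemannZeta (1 / 2 + t * I) * conj (mainSum κ Ns t) * Mt a N t * conj (Mt a N t))
      = w t * (ZL t * Fp t) + w t * (Rem t * Fp t)
    have e := hwF (fun t => riemannZeta (1 / 2 + t * I)) t
    simp only [hF] at e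
    rw [show riemannZeta (1 / 2 + t * I) * conj (mainSum κ Ns t) * Mt a N t * conj (Mt a N t)
      = riemannZeta (1 / 2 + t * I) * (conj (mainSum κ Ns t) * Mt a N t * conj (Mt a N t)) by ring, e]
    simp only [hRem]; ring
  -- the main part: generic lemma on `I2set`
  set S : Finset ((ℕ × ℕ) × (ℕ × ℕ)) := I2set L Ns N with hS
  set c : (ℕ × ℕ) × (ℕ × ℕ) → ℂ := I2coef a with hc
  set fr : (ℕ × ℕ) × (ℕ × ℕ) → ℝ := fun q =>
    (Real.log q.1.2 + Real.log q.2.2) - (Real.log q.1.1 + Real.log q.2.1) with hfr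
  set A : (ℕ × ℕ) × (ℕ × ℕ) → ℝ → ℂ := fun q => prof κ q.1.2 with hA
  have hexp : ∀ t : ℝ, ZL t * Fp t = ∑ q ∈ S, c q * A q t * cexp (I * fr q * t) := by
    intro t
    -- `(Z_L Sp) (M conj M)`
    have h1 : ZL t * Sp t = ∑ p ∈ Finset.Icc 1 L ×ˢ Finset.Icc 1 Ns,
        prof κ p.2 t * ((((p.1 : ℝ) ^ (-(1 / 2 : ℝ)) : ℝ) : ℂ) * (((p.2 : ℝ) ^ (-(1 / 2 : ℝ)) : ℝ) : ℂ))
          * cexp (I * ((Real.log p.2 - Real.log p.1 : ℝ) : ℂ) * (t : ℂ)) := by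
      rw [hZL, hSp]
      simp only
      rw [Finset.sum_mul_sum, Finset.sum_product]
      refine Finset.sum_congr rfl fun ℓ hℓ => Finset.sum_congr rfl fun n _ => ?_
      rw [hZLterm (Finset.mem_Icc.1 hℓ).1 t]
      have : cexp (I * ((-Real.log ℓ : ℝ) : ℂ) * (t : ℂ)) * cexp (I * ((Real.log n : ℝ) : ℂ) * (t : ℂ))
          = cexp (I * ((Real.log n - Real.log ℓ : ℝ) : ℂ) * (t : ℂ)) := by
        rw [← Complex.exp_add]; congr 1; push_cast; ring
      calc (((ℓ : ℝ) ^ (-(1 / 2 : ℝ)) : ℝ) : ℂ) * cexp (I * ((-Real.log ℓ : ℝ) : ℂ) * (t : ℂ))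
            * (prof κ n t * (((n : ℝ) ^ (-(1 / 2 : ℝ)) : ℝ) : ℂ) * cexp (I * ((Real.log n : ℝ) : ℂ) * (t : ℂ)))
          = prof κ n t * ((((ℓ : ℝ) ^ (-(1 / 2 : ℝ)) : ℝ) : ℂ) * (((n : ℝ) ^ (-(1 / 2 : ℝ)) : ℝ) : ℂ))
            * (cexp (I * ((-Real.log ℓ : ℝ) : ℂ) * (t : ℂ)) * cexp (I * ((Real.log n : ℝ) : ℂ) * (t : ℂ))) := by
            ring
        _ = _ := by rw [this]
    have h2 : Mt a N t * conj (Mt a N t) = ∑ p ∈ Finset.Icc 1 N ×ˢ Finset.Icc 1 N,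
        (a p.1 * (((p.1 : ℝ) ^ (-(1 / 2 : ℝ)) : ℝ) : ℂ) * (conj (a p.2) * (((p.2 : ℝ) ^ (-(1 / 2 : ℝ)) : ℝ) : ℂ)))
          * cexp (I * ((Real.log p.2 - Real.log p.1 : ℝ) : ℂ) * (t : ℂ)) := by
      rw [conj_Mt_eq_sum, Mt_eq_sum, Finset.sum_mul_sum, Finset.sum_product]
      refine Finset.sum_congr rfl fun k _ => Finset.sum_congr rfl fun h _ => ?_
      have : cexp (I * ((-Real.log k : ℝ) : ℂ) * (t : ℂ)) * cexp (I * ((Real.log h : ℝ) : ℂ) * (t : ℂ))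
          = cexp (I * ((Real.log h - Real.log k : ℝ) : ℂ) * (t : ℂ)) := by
        rw [← Complex.exp_add]; congr 1; push_cast; ring
      calc a k * (((k : ℝ) ^ (-(1 / 2 : ℝ)) : ℝ) : ℂ) * cexp (I * ((-Real.log k : ℝ) : ℂ) * (t : ℂ))
            * (conj (a h) * (((h : ℝ) ^ (-(1 / 2 : ℝ)) : ℝ) : ℂ) * cexp (I * ((Real.log h : ℝ) : ℂ) * (t : ℂ)))
          = a k * (((k : ℝ) ^ (-(1 / 2 : ℝ)) : ℝ) : ℂ) * (conj (a h) * (((h : ℝ) ^ (-(1 / 2 : ℝ)) : ℝ) : ℂ))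
            * (cexp (I * ((-Real.log k : ℝ) : ℂ) * (t : ℂ)) * cexp (I * ((Real.log h : ℝ) : ℂ) * (t : ℂ))) := by
            ring
        _ = _ := by rw [this]
    calc ZL t * Fp t = (ZL t * Sp t) * (Mt a N t * conj (Mt a N t)) := by simp only [hFp]; ring
      _ = ∑ q ∈ S, c q * A q t * cexp (I * fr q * t) := by
          rw [h1, h2, Finset.sum_mul_sum]
          conv_rhs => rw [hS, I2set, Finset.sum_product]
          refine Finset.sum_congr rfl fun p _ => Finset.sum_congr rfl fun p' _ => ?_
          simp only [hc, I2coef, hA, hfr]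
          have : cexp (I * ((Real.log p.2 - Real.log p.1 : ℝ) : ℂ) * (t : ℂ))
              * cexp (I * ((Real.log p'.2 - Real.log p'.1 : ℝ) : ℂ) * (t : ℂ))
              = cexp (I * (((Real.log p.2 + Real.log p'.2) - (Real.log p.1 + Real.log p'.1) : ℝ) : ℂ) * (t : ℂ)) := by
            rw [← Complex.exp_add]; congr 1; push_cast; ring
          calc prof κ p.2 t * ((((p.1 : ℝ) ^ (-(1 / 2 : ℝ)) : ℝ) : ℂ) * (((p.2 : ℝ) ^ (-(1 / 2 : ℝ)) : ℝ) : ℂ))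
                * cexp (I * ((Real.log p.2 - Real.log p.1 : ℝ) : ℂ) * (t : ℂ))
                * ((a p'.1 * (((p'.1 : ℝ) ^ (-(1 / 2 : ℝ)) : ℝ) : ℂ) * (conj (a p'.2) * (((p'.2 : ℝ) ^ (-(1 / 2 : ℝ)) : ℝ) : ℂ)))
                  * cexp (I * ((Real.log p'.2 - Real.log p'.1 : ℝ) : ℂ) * (t : ℂ)))
              = ((((p.1 : ℝ) ^ (-(1 / 2 : ℝ)) : ℝ) : ℂ) * (((p.2 : ℝ) ^ (-(1 / 2 : ℝ)) : ℝ) : ℂ))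
                * (a p'.1 * (((p'.1 : ℝ) ^ (-(1 / 2 : ℝ)) : ℝ) : ℂ) * (conj (a p'.2) * (((p'.2 : ℝ) ^ (-(1 / 2 : ℝ)) : ℝ) : ℂ)))
                * prof κ p.2 t
                * (cexp (I * ((Real.log p.2 - Real.log p.1 : ℝ) : ℂ) * (t : ℂ))
                  * cexp (I * ((Real.log p'.2 - Real.log p'.1 : ℝ) : ℂ) * (t : ℂ))) := by ring
            _ = _ := by rw [this]
  -- membership facts
  have hmemS : ∀ q ∈ S, (1 ≤ q.1.1 ∧ q.1.1 ≤ L) ∧ (1 ≤ q.1.2 ∧ q.1.2 ≤ Ns)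
      ∧ (1 ≤ q.2.1 ∧ q.2.1 ≤ N) ∧ (1 ≤ q.2.2 ∧ q.2.2 ≤ N) := by
    intro q hq
    simp only [hS, I2set, Finset.mem_product, Finset.mem_Icc] at hq
    exact ⟨hq.1.1, hq.1.2, hq.2.1, hq.2.2⟩
  have hfr_eq : ∀ q ∈ S, fr q = Real.log ((q.1.2 * q.2.2 : ℕ) : ℝ) - Real.log ((q.1.1 * q.2.1 : ℕ) : ℝ) := by
    intro q hq
    obtain ⟨h1, h2, h3, h4⟩ := hmemS q hq
    have n1 : ((q.1.1 : ℕ) : ℝ) ≠ 0 := by exact_mod_cast (show q.1.1 ≠ 0 by omega)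
    have n2 : ((q.1.2 : ℕ) : ℝ) ≠ 0 := by exact_mod_cast (show q.1.2 ≠ 0 by omega)
    have n3 : ((q.2.1 : ℕ) : ℝ) ≠ 0 := by exact_mod_cast (show q.2.1 ≠ 0 by omega)
    have n4 : ((q.2.2 : ℕ) : ℝ) ≠ 0 := by exact_mod_cast (show q.2.2 ≠ 0 by omega)
    simp only [hfr]; push_cast
    rw [Real.log_mul n2 n4, Real.log_mul n1 n3]
  have hfr0 : ∀ q ∈ S, fr q = 0 ↔ I2res q := by
    intro q hq
    obtain ⟨h1, h2, h3, h4⟩ := hmemS q hq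
    rw [hfr_eq q hq, sub_eq_zero, I2res]
    constructor
    · intro h
      have hpos1 : (0 : ℝ) < ((q.1.2 * q.2.2 : ℕ) : ℝ) := Nat.cast_pos.2 (Nat.mul_pos h2.1 h4.1)
      have hpos2 : (0 : ℝ) < ((q.1.1 * q.2.1 : ℕ) : ℝ) := Nat.cast_pos.2 (Nat.mul_pos h1.1 h3.1)
      have := Real.log_injOn_pos (Set.mem_Ioi.2 hpos1) (Set.mem_Ioi.2 hpos2) h
      exact_mod_cast this
    · intro h; rw [h]
  have hYpos : (1 : ℝ) ≤ (Ns : ℝ) * N := by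
    have : (1 : ℝ) ≤ Ns := by exact_mod_cast hNs
    have : (1 : ℝ) ≤ N := by exact_mod_cast hN
    nlinarith
  have hsep : ∀ q ∈ S, fr q ≠ 0 → 1 / (2 * ((Ns : ℝ) * N)) ≤ |fr q| := by
    intro q hq hne
    obtain ⟨h1, h2, h3, h4⟩ := hmemS q hq
    rw [hfr_eq q hq, abs_sub_comm]
    have hne' : q.1.1 * q.2.1 ≠ q.1.2 * q.2.2 := fun h => hne ((hfr0 q hq).2 (by rw [I2res]; exact h.symm))
    refine abs_log_sub_log_ge_inv' (Nat.mul_pos h1.1 h3.1) (Nat.mul_pos h2.1 h4.1) hne' hYpos ?_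
    push_cast
    exact mul_le_mul (by exact_mod_cast h2.2) (by exact_mod_cast h4.2) (by positivity) (by positivity)
  have hAcd : ∀ q ∈ S, ContDiff ℝ ∞ (A q) := fun q _ => contDiff_weightProfile hκ _
  have hAB : ∀ q ∈ S, ∀ j ≤ k, ∀ t ∈ Set.Icc T (2 * T), ‖iteratedDeriv j (A q) t‖ ≤ B / T ^ j := by
    intro q hq j hj t ht
    obtain ⟨_, h2, _, _⟩ := hmemS q hq
    exact hBρ _ h2.1 j hj t ht.1
  have hgen := norm_integral_window_expSum_sub_le S c fr A hH hHT k hB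
    (by positivity : (0 : ℝ) < 1 / (2 * ((Ns : ℝ) * N))) hAcd hAB hsep
  have hmain_eq : (∫ t, w t * (ZL t * Fp t)) = ∫ t, w t * ∑ q ∈ S, c q * A q t * cexp (I * fr q * t) := by
    refine integral_congr_ae (Filter.Eventually.of_forall fun t => ?_); simp only [hexp t]
  have hdiag_eq : ∑ q ∈ S.filter (fun q => fr q = 0), c q * ∫ t, w t * A q t = I2diag a κ L Ns N T H := by
    rw [I2diag, ← hS]
    have : S.filter (fun q => fr q = 0) = S.filter (fun q => I2res q) :=
      Finset.filter_congr fun q hq => hfr0 q hq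
    rw [this]
  -- the coefficient sum
  have hcsum : ∑ q ∈ S, ‖c q‖ ≤ 4 * Real.sqrt L * Real.sqrt Ns
      * (∑ k ∈ Finset.Icc 1 N, ‖a k‖ * (k : ℝ) ^ (-(1 / 2 : ℝ))) ^ 2 := by
    set f : ℕ → ℝ := fun ℓ => (ℓ : ℝ) ^ (-(1 / 2 : ℝ)) with hf
    set u : ℕ → ℝ := fun k => ‖a k‖ * (k : ℝ) ^ (-(1 / 2 : ℝ)) with hu
    have h0 : ∑ q ∈ S, ‖c q‖ = ∑ ℓ ∈ Finset.Icc 1 L, ∑ n ∈ Finset.Icc 1 Ns,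
        ∑ k ∈ Finset.Icc 1 N, ∑ h ∈ Finset.Icc 1 N, (f ℓ * f n) * (u k * u h) := by
      rw [hS, I2set, Finset.sum_product, Finset.sum_product]
      refine Finset.sum_congr rfl fun ℓ hℓ => Finset.sum_congr rfl fun n hn => ?_
      rw [Finset.sum_product]
      refine Finset.sum_congr rfl fun k hk => Finset.sum_congr rfl fun h hh => ?_
      rw [hc, norm_I2coef (a := a) (q := ((ℓ, n), (k, h))) (Finset.mem_Icc.1 hℓ).1 (Finset.mem_Icc.1 hn).1
        (Finset.mem_Icc.1 hk).1 (Finset.mem_Icc.1 hh).1]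
    have hinner : ∀ x : ℝ, ∑ k ∈ Finset.Icc 1 N, ∑ h ∈ Finset.Icc 1 N, x * (u k * u h)
        = x * ((∑ k ∈ Finset.Icc 1 N, u k) * ∑ h ∈ Finset.Icc 1 N, u h) := by
      intro x
      rw [Finset.sum_mul_sum, Finset.mul_sum]
      refine Finset.sum_congr rfl fun k _ => ?_
      rw [Finset.mul_sum]
    have h1 : ∑ q ∈ S, ‖c q‖ = ((∑ ℓ ∈ Finset.Icc 1 L, f ℓ) * ∑ n ∈ Finset.Icc 1 Ns, f n)
        * ((∑ k ∈ Finset.Icc 1 N, u k) * ∑ h ∈ Finset.Icc 1 N, u h) := by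
      rw [h0]
      simp_rw [hinner, ← Finset.sum_mul]
      rw [← Finset.sum_mul_sum]
    rw [h1]
    have eL : ∑ ℓ ∈ Finset.Icc 1 L, f ℓ ≤ 2 * Real.sqrt L := AFE.sum_Icc_rpow_neg_half_le L
    have eN : ∑ n ∈ Finset.Icc 1 Ns, f n ≤ 2 * Real.sqrt Ns := AFE.sum_Icc_rpow_neg_half_le Ns
    have p1 : 0 ≤ ∑ ℓ ∈ Finset.Icc 1 L, f ℓ := Finset.sum_nonneg fun _ _ => by positivity
    have p2 : 0 ≤ ∑ n ∈ Finset.Icc 1 Ns, f n := Finset.sum_nonneg fun _ _ => by positivity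
    have p3 : 0 ≤ ∑ k ∈ Finset.Icc 1 N, u k := Finset.sum_nonneg fun _ _ => by positivity
    rw [← sq]
    have : (∑ ℓ ∈ Finset.Icc 1 L, f ℓ) * (∑ n ∈ Finset.Icc 1 Ns, f n)
        ≤ (2 * Real.sqrt L) * (2 * Real.sqrt Ns) := mul_le_mul eL eN p2 (by positivity)
    nlinarith [mul_le_mul_of_nonneg_right this (sq_nonneg (∑ k ∈ Finset.Icc 1 N, u k))]
  -- the remainder part by AM–GM
  have hrem : ‖∫ t, w t * (Rem t * Fp t)‖
      ≤ 12 * T ^ (-(1 / 4 : ℝ)) * (ε / 2 * (∫ t, dyadicWindowRe T H t * ‖mainSum κ Ns t * Mt a N t‖ ^ 2)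
          + ε⁻¹ / 2 * (∫ t, dyadicWindowRe T H t * ‖Mt a N t‖ ^ 2)) := by
    -- pointwise bound
    have hpt : ∀ t, ‖w t * (Rem t * Fp t)‖ ≤ 12 * T ^ (-(1 / 4 : ℝ))
        * (ε / 2 * (dyadicWindowRe T H t * ‖mainSum κ Ns t * Mt a N t‖ ^ 2)
          + ε⁻¹ / 2 * (dyadicWindowRe T H t * ‖Mt a N t‖ ^ 2)) := by
      intro t
      have hwre := dyadicWindowRe_mem_Icc hH0 hHT t
      by_cases ht : t ∈ Set.Icc T (2 * T)
      · have htpos : 0 < t := by linarith [ht.1]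
        have e := hwF Rem t
        rw [← e, norm_mul, hw, dyadicWindow_eq_ofReal, Complex.norm_real, Real.norm_eq_abs,
          abs_of_nonneg hwre.1, norm_mul]
        have hR := norm_zeta_half_sub_sum_le hT ht
        have hFn : ‖F t‖ = ‖mainSum κ Ns t * Mt a N t‖ * ‖Mt a N t‖ := by
          simp only [hF, norm_mul, Complex.norm_conj]
        rw [hFn]
        have ham := mul_le_amgm ‖mainSum κ Ns t * Mt a N t‖ ‖Mt a N t‖ hε
        have h12 : 0 ≤ 12 * T ^ (-(1 / 4 : ℝ)) := by positivity
        calc dyadicWindowRe T H t * (‖Rem t‖ * (‖mainSum κ Ns t * Mt a N t‖ * ‖Mt a N t‖))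
            ≤ dyadicWindowRe T H t * ((12 * T ^ (-(1 / 4 : ℝ)))
                * ((ε * ‖mainSum κ Ns t * Mt a N t‖ ^ 2 + ε⁻¹ * ‖Mt a N t‖ ^ 2) / 2)) := by
              refine mul_le_mul_of_nonneg_left ?_ hwre.1
              exact mul_le_mul hR ham (by positivity) h12
          _ = _ := by ring
      · have : w t = 0 := by
          by_contra h
          exact ht (support_dyadicWindow_subset hH0 hHT (Function.mem_support.2 (by rwa [hw] at h)))
        rw [this, zero_mul, norm_zero]
        have h12 : 0 ≤ 12 * T ^ (-(1 / 4 : ℝ)) := by positivity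
        have : 0 ≤ ε / 2 * (dyadicWindowRe T H t * ‖mainSum κ Ns t * Mt a N t‖ ^ 2)
            + ε⁻¹ / 2 * (dyadicWindowRe T H t * ‖Mt a N t‖ ^ 2) := by
          have := hwre.1; positivity
        positivity
    have hintR : Integrable fun t => 12 * T ^ (-(1 / 4 : ℝ))
        * (ε / 2 * (dyadicWindowRe T H t * ‖mainSum κ Ns t * Mt a N t‖ ^ 2)
          + ε⁻¹ / 2 * (dyadicWindowRe T H t * ‖Mt a N t‖ ^ 2)) :=
      ((hintSM.const_mul _).add (hintM.const_mul _)).const_mul _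
    calc ‖∫ t, w t * (Rem t * Fp t)‖ ≤ ∫ t, ‖w t * (Rem t * Fp t)‖ := norm_integral_le_integral_norm _
      _ ≤ ∫ t, 12 * T ^ (-(1 / 4 : ℝ))
          * (ε / 2 * (dyadicWindowRe T H t * ‖mainSum κ Ns t * Mt a N t‖ ^ 2)
            + ε⁻¹ / 2 * (dyadicWindowRe T H t * ‖Mt a N t‖ ^ 2)) :=
          integral_mono_of_nonneg (Filter.Eventually.of_forall fun t => norm_nonneg _) hintR
            (Filter.Eventually.of_forall hpt)
      _ = _ := by
          rw [MeasureTheory.integral_const_mul, integral_add (hintSM.const_mul _) (hintM.const_mul _),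
            MeasureTheory.integral_const_mul, MeasureTheory.integral_const_mul]
  -- assemble
  rw [hsplit, hmain_eq, ← hdiag_eq]
  have hμ : (1 / (2 * ((Ns : ℝ) * N))) = 1 / (2 * (Ns : ℝ) * N) := by ring
  calc ‖(∫ t, w t * ∑ q ∈ S, c q * A q t * cexp (I * fr q * t)) + (∫ t, w t * (Rem t * Fp t))
          - ∑ q ∈ S.filter (fun q => fr q = 0), c q * ∫ t, w t * A q t‖
      = ‖((∫ t, w t * ∑ q ∈ S, c q * A q t * cexp (I * fr q * t))
            - ∑ q ∈ S.filter (fun q => fr q = 0), c q * ∫ t, w t * A q t)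
          + ∫ t, w t * (Rem t * Fp t)‖ := by ring_nf
    _ ≤ ‖(∫ t, w t * ∑ q ∈ S, c q * A q t * cexp (I * fr q * t))
            - ∑ q ∈ S.filter (fun q => fr q = 0), c q * ∫ t, w t * A q t‖
          + ‖∫ t, w t * (Rem t * Fp t)‖ := norm_add_le _ _
    _ ≤ (∑ q ∈ S, ‖c q‖) * (oscDecayConst k * B * T / (H * (1 / (2 * ((Ns : ℝ) * N)))) ^ k)
          + 12 * T ^ (-(1 / 4 : ℝ)) * (ε / 2 * (∫ t, dyadicWindowRe T H t * ‖mainSum κ Ns t * Mt a N t‖ ^ 2)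
              + ε⁻¹ / 2 * (∫ t, dyadicWindowRe T H t * ‖Mt a N t‖ ^ 2)) := add_le_add hgen hrem
    _ ≤ _ := by
        rw [hμ]
        have h0 : 0 ≤ oscDecayConst k * B * T / (H * (1 / (2 * (Ns : ℝ) * N))) ^ k := by
          have := oscDecayConst_nonneg k
          positivity
        nlinarith [mul_le_mul_of_nonneg_right hcsum h0]


end PropBMoments

end Literature.Barriers.RiemannHypothesis
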